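import Summits.BirchSwinnertonDyer.BirchSwinnertonDyer.Theses.UniversalToricDescent
import Summits.BirchSwinnertonDyer.BirchSwinnertonDyer.Theorems.UniversalToricDescentAcDualMuZeroCriterion
import HarnessLib

/-!
# utd-idea g65 — the CHARACTERWISE ONE-POINT SQUEEZE for crux 24737 `TwinAlgMuZeroAtThree`
(successor of `Sketch_utd_idea_g64.lean` v5: §0–§10 verbatim, plus §11 = P2′ PROVED and the WEAKEST transfer `C⁺_weak`,
§13 = the supersingular KOBAYASHI-DEFECT budget `2·d_m ≤ (3/4)·φ(3^m)` PROVED and the defect-adjusted transfer;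
v3 = v2 + prose-only amendment: the model defect is `kobDefect 3 m + O(1)`, the `O(1)` a bottom-layer term absorbed by `B`;
v4 = v3 + §14: the resolvent factorisation `R_χ = ζ·ω_m/(X − (ζ−1))` and the cost of each lower-level factor PROVED — the
imprimitivity of §13 is EXACTLY `π^{kobDefect 3 m}` and is REMOVED by the isotypic (`±`) renormalisation `z^{iso} = F̃(γ−1)·z`,
so the SHARP `C⁺` is what the method proves (modulo U1/U2) and the slack road of §13 is the insurance)

Crux (verbatim, route file l.566): `μ^alg = 0 ∧ Λ-torsion` for Castella's dual `X′ = XAc (W′/K) 3 κ 𝔭′ ∅ γ` of a bucket-B /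
bucket-C₀ twin `E′` at `p = 3`.

MECHANISM (unchanged).  For a finitely generated `Λ = ℤ₃⟦T⟧`-module `X` and the character polynomials `Φ_m := Φ_{3^m}(1+T)`
(`cycLayer m`), `log₃ #(X/Φ_m X) = μ(X)·φ(3^m) + λ(X) + O(1)`; the arithmetic input is ONE finite-level inequality per character
`χ` of conductor `3^m`: `#(X′/Φ_m X′)·‖L′(ζ_χ − 1)‖^{φ(3^m)} ≤ 3^{error}` (finite-level `χ`-twisted Heegner–Kolyvagin over `K`, the
GLOBAL index of the Heegner class cancelling in the Poitou–Tate comparison `(∅,0)` vs Bloch–Kato; `p`-adic Waldspurger/BDP at the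
RAMIFIED character `χ`; control at `χ`), and the frame's analytic `μ(L′) = 0` turns the left side into `#(X′/Φ_m X′)·3^{-λ′}`.

NEW IN g65 (§11, all PROVED, sorry-free):
* `finite_augQuot_of_frequentlySublinearCharLayers` — **P2′ PROVED in its sparse form, with NO structure theory**: if
  `#(X/Φ_m X) ≤ 3^{c·φ(3^m)+B}` for some `c < 1` along an UNBOUNDED set of levels `m`, then `X/3X` is finite.  Proof: the chain
  `M_n = (Tⁿ,3)X` has successive quotients killed by `3`, so each strict step costs a factor `≥ 3`; were every step strict,
  `#(X/M_{φ(3^m)}) ≥ 3^{φ(3^m)}` would contradict the bound once `(1−c)φ(3^m) > B`; a non-strict step feeds the Nakayama tail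
  of P2.  Hence `sublinearCharLayersCriterion_holds : SublinearCharLayersCriterion` (§9's typed P2′) and
  `TwinAlgMuZeroAtThree_of_onePointSqueezeSlack'` — the slack transfer is now UNCONDITIONAL in the algebra.
* `TwistedOnePointKolyvaginAtThreeWeak` (`C⁺_weak` = sparse ∧ slack: error `c·φ(3^m) + B`, `c < 1`, along infinitely many `m`),
  `weak_of_slack`, `weak_of_sparse`, `weak_of_C_plus`, and **`TwinAlgMuZeroAtThree_of_onePointSqueezeWeak : C⁺_weak →
  TwinFrameMuSupplyAtThree → TwinAlgMuZeroAtThree`** (concludes the crux BY NAME).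
* ERROR TAXONOMY (corrects g64's O(1) optimism; memo g65 §2).  LENGTH-unit errors (`log₃` of the order of a finite module:
  control kernels/cokernels, twisted (co)invariants at the finitely decomposed bad primes, `E′(K_m)[3] = 0`, local torsion) are
  `O(1)` or `O(m)` and harmless — the squeeze tolerates anything `o(φ(3^m))`.  VALUATION-unit normalisations (Gauss sum
  `v₃ 𝔤(χ_𝔭⁻¹) = n/2`, the factor `p⁻ⁿ`, `v₃ log_ω` of local generators) enter multiplied by `φ(3^m)` and must cancel EXACTLY — and
  they do: Castella–Hsieh 2018 Thm. 4.8 (ordinary-free, characters of conductor `pⁿ`, `n ≥ 2`, under `p ∤ 2Nφ(N)`) gives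
  `v₃ ℒ(χ) = v₃ log_ω(R_χ z) − n/2`, and `v₃ log_ω(R_χ d_m) = n/2` for Kobayashi's local generator, so `φ(3^m)·v₃ L′(ζ−1) =
  2·[index of the Heegner RESOLVENT R_χ(z) in the local RESOLVENT line]` with NO linear error.
* §13 THE ONE GENUINELY LINEAR TERM: the algebraic side (Bloch–Kato `H¹_f(K_𝔭, T_χ)` = the `χ̄`-ISOTYPIC part of the local
  formal points, by inflation–restriction) and the analytic side (the RESOLVENT line) differ by the Kobayashi defect `d_χ` of the
  height-2 formal group, `= kobDefect 3 m + O(1)`, `kobDefect 3 m = Σ_{1≤k<m, k≢m (2)} φ(3^k)` (`d_2,d_3,d_4 = 2,6,20`; the `O(1)` is a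
  bottom-layer term: `∈ {0,1}` in the cyclotomic model, in general bounded by `v₃` of the tower's bottom trace coefficient); a twisted
  Kolyvagin argument with the standard `f`-structure therefore proves `#·|L′|^φ ≤ 3^{2d_χ + err}`, slope `2p/(p²−1) = 3/4` at
  `p = 3` — FATAL for the plain `C⁺` ALONG THE RESOLVENT ROAD (§14: not along the isotypic road), HARMLESS for `C⁺_weak`
  because `3/4 < 1`: `two_mul_kobDefect_three_le`
  (PROVED), `TwistedKolyvaginWithKobayashiDefectAtThree` (error budget `c' < 1/4` for Kolyvagin), `weak_of_defect` and
  **`TwinAlgMuZeroAtThree_of_kolyvaginWithKobayashiDefect`** (PROVED, concludes the crux BY NAME).  Remaining unknowns: U1 =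
  `m`-uniformity of Howard's DVR Kolyvagin bound over `O_χ` (budget: slope `< 1/4`; any `o(φ)` suffices), U2 = transfer of the
  model value `d_χ = kobDefect 3 m + O(1)` to the anticyclotomic local tower at the split prime (Kobayashi 2013 §3: relative Lubin–Tate
  towers `W[ϖ_n]`, `ϖ ∈ ℤ₃`, contain it; generation of `Ê(𝔪_n)`, proof of Prop. 3.12), ask F5 = an exact local computation.
* §14 THE IMPRIMITIVITY IS EXACT AND REMOVABLE: `R_χ = ζ·ω_m/(X − (ζ−1))` (`resolvent_mul_eq`, PROVED), the `a₃ = 0` trace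
  relations make `F = ω_m^{ε(m)}` annihilate every Heegner point of `3`-level `m`, so `z^{iso}_χ := (F/(X−(ζ−1)))(γ−1)·z_m` is an
  isotypic (= genuine `H¹(K,T_χ)`) class with `R_χ(z_m) = ω̃_m^{−ε}(ζ̄−1)·z^{iso}_χ`, `v_π(ω̃^{−ε}_m(ζ−1)) = kobDefect 3 m` EXACTLY
  (`norm_prod_sub_lower_level_roots`, PROVED); Kolyvagin with `κ^{iso}` is SHARP (the plain `C⁺`, modulo U1/U2), Kolyvagin with
  `κ^{res}` is the slack road of §13.  Print lineage: the Λ-adic `±` Heegner classes of Castella–Wan arXiv:1607.02019 §5.1 (`p > 3`).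

Nothing here is a route item; `TwistedOnePointKolyvaginAtThree{,Slack,Sparse,Weak}` are the card's transfers (`C⁺ ⇒ C⁺_slack,
C⁺_sparse ⇒ C⁺_weak`), the rest are support Props and PROVED theorems (§1 endgame, §4 bookkeeping, §5 P2, §6 P0, §7 P1, §8
transfer, §9 slack, §10 sparse, §11 P2′ + weak, §13 defect budget + defect-adjusted transfer, §14 resolvent factorisation +
isotypic renormalisation, §12 audit).
-/

noncomputable section

-- `…BirchSwinnertonDyer.BirchSwinnertonDyer…` is the problem's mandated namespace (D-0017).
set_option linter.dupNamespace false
set_option autoImplicit false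

open Literature.NumberTheory.EllipticCurves Literature.NumberTheory.EllipticCurves.IwasawaAlgebra
  Literature.NumberTheory.EllipticCurves.IwasawaModuleFinitePadicInt
  NumberField IsDedekindDomain Field
  Summit.BirchSwinnertonDyer.Rank1Residual.X11b Summit.BirchSwinnertonDyer.Rank1Residual.X11b.AcSelmer
  Summit.BirchSwinnertonDyer.BirchSwinnertonDyer.Theorems.UniversalToricDescentAcDualMuZero

namespace Summit.BirchSwinnertonDyer.BirchSwinnertonDyer.Cruxes.TwinAlgMuZeroAtThree.OnePointSqueeze

/-! ### §0 The character polynomials `Φ_{3^m}(1+T) ∈ Λ = ℤ₃⟦T⟧` -/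

/-- `Φ_{3^m}(1+T) = 1 + (1+T)^{3^{m-1}} + (1+T)^{2·3^{m-1}}` (`m ≥ 1`): its zeros in the open disc are the
`ζ − 1`, `ζ` a primitive `3^m`-th root of unity, i.e. the characters of `Γ` of exact order `3^m` (`γ ↦ 1+T`);
`Φ_m ≡ T^{φ(3^m)} (mod 3)`. -/
def cycLayer (m : ℕ) : IwasawaAlgebra 3 :=
  ∑ i ∈ Finset.range 3, (1 + PowerSeries.X) ^ (i * 3 ^ (m - 1))

/-- The `m`-th CHARACTER LAYER of a `Λ`-module: `X / Φ_{3^m}(γ) X` (for `X = X_ac` this is, up to a bounded control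
error, the Pontryagin dual of `⊕_{χ of order 3^m} Sel_{(∅,0)}(K, E′[3^∞] ⊗ χ)`, a module over `ℤ₃[ζ_{3^m}]`). -/
abbrev CharLayer (X : Type) [AddCommGroup X] [Module (IwasawaAlgebra 3) X] (m : ℕ) : Type :=
  X ⧸ (Ideal.span {cycLayer m} • (⊤ : Submodule (IwasawaAlgebra 3) X))

/-! ### §1 Pure `Λ`-algebra: bounded character layers ⟹ torsion ∧ μ = 0 -/

/-- **Bounded character layers**: `#(X/Φ_m X) ≤ 3^B` for all `m ≥ m₀` (finite, of bounded order). -/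
def BoundedCharLayers (X : Type) [AddCommGroup X] [Module (IwasawaAlgebra 3) X] : Prop :=
  ∃ B m₀ : ℕ, ∀ m : ℕ, m₀ ≤ m → Finite (CharLayer X m) ∧ Nat.card (CharLayer X m) ≤ 3 ^ B

/-- **P2 (support, pure algebra; to be PROVED).** For a finitely generated `Λ`-module, bounded character layers force
`X/3X` finite (`Φ_m ≡ T^{φ(3^m)} (mod 3)`, so `#(X/(3,T^n)X)` is bounded along `n = φ(3^m) → ∞`; the chain `TⁿX̄` in
`X̄ = X/3X` stabilises, Nakayama with `T ∈ rad Λ` kills it, `X̄` is finite).  With the tree this gives `X` finitely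
generated over `ℤ₃`, hence `Λ`-torsion with `μ = 0` (Washington §13.2; tree `moduleFinite_padicInt_of_finite_quotient_augIdealP`). -/
def BoundedCharLayersCriterion : Prop :=
  ∀ (X : Type) [AddCommGroup X] [Module (IwasawaAlgebra 3) X] [Module.Finite (IwasawaAlgebra 3) X],
    BoundedCharLayers X → Finite (X ⧸ (augIdealP 3 • (⊤ : Submodule (IwasawaAlgebra 3) X)))

/-- **ENDGAME (PROVED composition on the crux's object).** Bounded character layers of Castella's dual
`X_ac(E/K_∞)` (any elliptic `W/K`, `Σ = ∅`) give EXACTLY the conclusion shape of `TwinAlgMuZeroAtThree`: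
`Λ`-torsion and `Ch_Λ(X)·R₀⟦T⟧ = (g)` with a norm-one coefficient. -/
theorem conclusion_of_boundedCharLayers (hcrit : BoundedCharLayersCriterion)
    {K : Type} [Field K] [NumberField K] (W : WeierstrassCurve K) [W.IsElliptic]
    (κ : ZpExtension K 3) (𝔭 : HeightOneSpectrum (𝓞 K)) (γ : absoluteGaloisGroup K)
    [Fact (κ.IsTopGenerator γ)] (hX : BoundedCharLayers (XAc W 3 κ 𝔭 ∅ γ)) :
    Module.IsTorsion (IwasawaAlgebra 3) (XAc W 3 κ 𝔭 ∅ γ) ∧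
      ∃ g : UnrSeries 3,
        (XAc.charIdeal W 3 κ 𝔭 ∅ γ).map (PowerSeries.map (Halves.toUnr 3)) = Ideal.span {g} ∧
          ∃ i : ℕ, ‖((PowerSeries.coeff i g : unrIntegers 3) : ℂ_[3])‖ = 1 := by
  haveI := XAc.module_finite κ 𝔭 ∅ γ Set.finite_empty (W := W)
  have hfin := hcrit (XAc W 3 κ 𝔭 ∅ γ) hX
  have hfg := moduleFinite_padicInt_of_finite_quotient_augIdealP 3 (XAc W 3 κ 𝔭 ∅ γ) hfin
  exact isTorsion_and_exists_generator_of_finite_pTorsion W 3 κ 𝔭 ∅ γ Set.finite_empty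
    (finite_pTorsion_of_moduleFinite_padicInt W 3 κ 𝔭 ∅ γ hfg)

/-! ### §2 The analytic side read at torsion points -/

/-- **P1 (support; Weierstrass preparation over `R₀ = unrIntegers 3`).** A power series `L ∈ R₀⟦T⟧` with a unit
coefficient (`μ(L) = 0`, Weierstrass degree `λ`) has `‖L(ζ − 1)‖ = ‖ζ − 1‖^λ` at every primitive `3^m`-th root of
unity `ζ` for `m ≫ 0` (the distinguished polynomial dominates: `v(ζ−1) = 1/φ(3^m) < v(c_i)/λ`).  Classical
(Iwasawa/Washington §7.3–§13.3 style); the converse limit formula `μ(L) = lim_m v₃ L(ζ_{3^m} − 1)` is why the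
squeeze loses nothing.  Elementary proof route (no Weierstrass preparation needed): the norm on `R₀ = 𝓞(\widehat{ℚ₃^{ur}})`
is DISCRETE (`‖c‖ < 1 ⇒ ‖c‖ ≤ 3⁻¹`); with `λ` the least index of a unit coefficient and `ρ = ‖ζ − 1‖ = 3^{-1/φ(3^m)}`,
the term `c_λ (ζ−1)^λ` has norm `ρ^λ`, every earlier term has norm `≤ 3⁻¹ < ρ^λ` once `φ(3^m) > λ`, every later
term has norm `≤ ρ^{λ+1} < ρ^λ`; the ultrametric inequality gives `‖L(ζ−1)‖ = ρ^λ`.  Only the LOWER bound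
`‖L(ζ−1)‖ ≥ ρ^λ` is used by the squeeze. -/
def UnitCoeffValuesAtTorsionPoints : Prop :=
  ∀ L : UnrSeries 3, (∃ i : ℕ, ‖((PowerSeries.coeff i L : unrIntegers 3) : ℂ_[3])‖ = 1) →
    ∃ lam m₀ : ℕ, ∀ m : ℕ, m₀ ≤ m → ∀ ζ : ℂ_[3], IsPrimitiveRoot ζ (3 ^ m) →
      ∀ v : ℂ_[3], L.HasValueAt (ζ - 1) v → ‖v‖ = ‖ζ - 1‖ ^ lam

/-- **P0 (support, folklore local fact).** For a primitive `3^m`-th root of unity `ζ ∈ ℂ₃` (`m ≥ 1`),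
`‖ζ − 1‖^{φ(3^m)} = ‖3‖ = 3⁻¹` (`∏_{a ∈ (ℤ/3^m)ˣ} (1 − ζ^a) = Φ_{3^m}(1) = 3`, all factors of equal norm). -/
def PrimitiveRootNormAtThree : Prop :=
  ∀ m : ℕ, 1 ≤ m → ∀ ζ : ℂ_[3], IsPrimitiveRoot ζ (3 ^ m) →
    ‖ζ - 1‖ ^ Nat.totient (3 ^ m) = (3 : ℝ)⁻¹

/-! ### §3 The arithmetic input: ONE finite-level inequality per character (the card's `C⁺`) -/

/-- **K1 = C⁺ (crux of the line, rank 2): TWISTED ONE-POINT KOLYVAGIN INEQUALITY AT 3.**  Binders = those of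
`TwinAlgMuZeroAtThree` (bucket guard B/C₀, mod-3 surjectivity, Heegner `K` of odd discriminant, `3 = 𝔭𝔭′`) plus a
BDP frame `L′` of `f_{E′}` at `(ι′, 𝔭)` (as in `TwinMuZeroAtThree` / `TwinWanFrameAtThreeGoodSSApZero`).  Conclusion:
there are `B, m₀` such that for every `m ≥ m₀` and every primitive `3^m`-th root of unity `ζ` (= character `χ` of `Γ`
of order `3^m`, `χ(γ) = ζ`) AT WHICH `L′(ζ − 1) ≠ 0` (non-torsion twisted Heegner class — the honest Kolyvagin guard;
the squeeze supplies non-vanishing for `m ≫ 0` from the analytic `μ = 0` via P1), the character layer `X′/Φ_m X′` of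
`X′ = X_ac(E′/K_∞)` strict at `𝔭′` is finite and `#(X′/Φ_m X′) · ‖L′(ζ − 1)‖^{φ(3^m)} ≤ 3^B`.
Informal proof plan (stubs of the line): (S1) control at `χ`: `X′/Φ_m X′ ≃ (⊕_{ord χ = 3^m} Sel_{(∅,0)}(K, A′_χ))^∨` up
to `O(1)`; (S2) finite-level Poitou–Tate: `ℓ(Sel_{(∅,0)}(K,A′_χ)^∨) ≤ ℓ(Ш_BK(K,A′_χ)) + 2·[locind_{𝔭′}(z_χ) − ind(z_χ)] + O(1)`
(`c` swaps `χ ↔ χ̄` and `𝔭 ↔ 𝔭′`, so the two local indices agree); (S3) `χ`-twisted Heegner–Kolyvagin over `K` for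
`T_χ = T₃E′ ⊗ O_χ(χ)`: `ℓ(Ш_BK(K,A′_χ)) ≤ 2·ind(z_χ) + O(1)` UNIFORMLY in `m` — the global index cancels against (S2);
(S4) `p`-adic Waldspurger at the ramified finite-order `χ`: `L′(χ̄)·(local resolvent factor) = unit·(log_{ω} z_χ)²`, i.e.
`2·locind_{𝔭′}(z_χ) = v_π(L′(ζ−1)) + O(1)`.  All `O(1)` are `O_χ`-lengths of `χ`-twisted coinvariants of FIXED finite
modules (Tamagawa, torsion, control), hence bounded independently of `m` (they are killed by `ζ_w − 1`, `v_π(ζ_w − 1) = 3^{a_w}`).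
Why it might fail: the `p = 3` Kolyvagin hypotheses (a unipotent generator in `ρ_{E′,3^∞}(G_{K_∞(μ_{3^∞})})` is automatic
only for full 3-adic image; mod-3 surjectivity alone leaves the Elkies-type index-3/27 images to check) and the ramified-`χ`
Waldspurger formula at `3 ∥ N′` (bucket B) are ports, not print. -/
def TwistedOnePointKolyvaginAtThree : Prop :=
  ∀ (W' : WeierstrassCurve ℚ) [W'.IsElliptic] [W'.IsGloballyMinimal] (N' : ℕ) [NeZero N'] (K : Type) [Field K]
    [NumberField K] (Dt' : Literature.NumberTheory.EllipticCurves.ModularForms.ModularParametrizationData W' N'),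
    (Literature.NumberTheory.EllipticCurves.Rank1Residual.Mult W' 3 ∧ ¬ 3 ∣ padicValInt 3 W'.minimalDiscriminantInt ∨
      Literature.NumberTheory.EllipticCurves.Rank1Residual.GoodSS W' 3 ∧ W'.frobeniusTrace 3 = 0) →
    W'.HasSurjectiveModNGaloisRep 3 → W'.conductorNorm ℤ = N' →
    Literature.NumberTheory.EllipticCurves.IsImaginaryQuadratic K →
    Literature.NumberTheory.EllipticCurves.SatisfiesHeegnerHypothesis N' K → Odd (NumberField.discr K) →
    ∀ (κ : Literature.NumberTheory.EllipticCurves.ZpExtension K 3), κ.IsAnticyclotomic →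
    ∀ (γ : Field.absoluteGaloisGroup K) [Fact (κ.IsTopGenerator γ)]
      (𝔭 : IsDedekindDomain.HeightOneSpectrum (NumberField.RingOfIntegers K)),
      ((3 : ℕ) : NumberField.RingOfIntegers K) ∈ 𝔭.asIdeal →
      𝔭.asIdeal.ramificationIdx (NumberField.RingOfIntegers ℚ) = 1 →
      𝔭.asIdeal.inertiaDeg (NumberField.RingOfIntegers ℚ) = 1 →
    ∀ (𝔭' : IsDedekindDomain.HeightOneSpectrum (NumberField.RingOfIntegers K)),
      ((3 : ℕ) : NumberField.RingOfIntegers K) ∈ 𝔭'.asIdeal → 𝔭' ≠ 𝔭 →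
    ∀ (ι' : PadicAlgCl 3 ≃+* ℂ),
      Summit.BirchSwinnertonDyer.BirchSwinnertonDyer.Theorems.SchneiderFree.BranchInducesPrime 3 ι' 𝔭 →
    ∀ (ΩK : ℂ) (Ωp : ℂ_[3]) (L' : Literature.NumberTheory.EllipticCurves.UnrSeries 3), ΩK ≠ 0 → Ωp ≠ 0 →
      Literature.NumberTheory.EllipticCurves.IsBDPLFunction ι' 𝔭 κ γ Dt'.f ΩK Ωp L' →
    ∃ B m₀ : ℕ, ∀ m : ℕ, m₀ ≤ m → ∀ ζ : ℂ_[3], IsPrimitiveRoot ζ (3 ^ m) → ∀ v : ℂ_[3], L'.HasValueAt (ζ - 1) v →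
      v ≠ 0 →
      Finite (CharLayer (Summit.BirchSwinnertonDyer.Rank1Residual.X11b.AcSelmer.XAc (W'.baseChange K) 3 κ 𝔭' ∅ γ) m) ∧
        (Nat.card (CharLayer (Summit.BirchSwinnertonDyer.Rank1Residual.X11b.AcSelmer.XAc (W'.baseChange K) 3 κ 𝔭' ∅ γ) m) : ℝ)
          * ‖v‖ ^ Nat.totient (3 ^ m) ≤ (3 : ℝ) ^ B

/-! ### §4 The squeeze: exponent bookkeeping (PROVED) -/

/-- **One character, one inequality (PROVED).** If `#(X/Φ_m X)·‖v‖^{φ(3^m)} ≤ 3^B`, `‖v‖ = ‖ζ−1‖^λ` and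
`‖ζ−1‖^{φ(3^m)} = ‖3‖ = 3⁻¹`, then `#(X/Φ_m X) ≤ 3^{B+λ}`. -/
theorem card_le_of_onePoint {c B lam φ : ℕ} {nv nz : ℝ}
    (hineq : (c : ℝ) * nv ^ φ ≤ (3 : ℝ) ^ B) (hv : nv = nz ^ lam) (hz : nz ^ φ = (3 : ℝ)⁻¹) :
    c ≤ 3 ^ (B + lam) := by
  have h3 : (0 : ℝ) < 3 := by norm_num
  have hpow : nv ^ φ = ((3 : ℝ) ^ lam)⁻¹ := by
    rw [hv, ← pow_mul, mul_comm, pow_mul, hz, inv_pow]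
  rw [hpow] at hineq
  have hlam : (0 : ℝ) < (3 : ℝ) ^ lam := pow_pos h3 lam
  have : (c : ℝ) ≤ (3 : ℝ) ^ B * (3 : ℝ) ^ lam := by
    have := mul_le_mul_of_nonneg_right hineq hlam.le
    rwa [mul_assoc, inv_mul_cancel₀ hlam.ne', mul_one] at this
  rw [← pow_add] at this
  exact_mod_cast this

/-- **THE SQUEEZE (PROVED modulo the four named Props): `C⁺` + analytic `μ = 0` (frame-wise) ⟹ bounded character
layers of `X′`, for every datum of `TwinAlgMuZeroAtThree` that carries a BDP frame `L′` with a unit coefficient.**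
Combined with `conclusion_of_boundedCharLayers` this is the crux's conclusion for that datum. -/
theorem boundedCharLayers_of_squeeze (hK : TwistedOnePointKolyvaginAtThree) (hP1 : UnitCoeffValuesAtTorsionPoints)
    (hP0 : PrimitiveRootNormAtThree)
    (hroots : ∀ m : ℕ, 1 ≤ m → ∃ ζ : ℂ_[3], IsPrimitiveRoot ζ (3 ^ m))
    (hval : ∀ (L : UnrSeries 3) (m : ℕ), 1 ≤ m → ∀ ζ : ℂ_[3], IsPrimitiveRoot ζ (3 ^ m) → ∃ v, L.HasValueAt (ζ - 1) v)
    (W' : WeierstrassCurve ℚ) [W'.IsElliptic] [W'.IsGloballyMinimal] (N' : ℕ) [NeZero N'] (K : Type) [Field K]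
    [NumberField K] (Dt' : Literature.NumberTheory.EllipticCurves.ModularForms.ModularParametrizationData W' N')
    (hbucket : Literature.NumberTheory.EllipticCurves.Rank1Residual.Mult W' 3 ∧
        ¬ 3 ∣ padicValInt 3 W'.minimalDiscriminantInt ∨
      Literature.NumberTheory.EllipticCurves.Rank1Residual.GoodSS W' 3 ∧ W'.frobeniusTrace 3 = 0)
    (hsurj : W'.HasSurjectiveModNGaloisRep 3) (hN : W'.conductorNorm ℤ = N')
    (hK' : Literature.NumberTheory.EllipticCurves.IsImaginaryQuadratic K)
    (hH : Literature.NumberTheory.EllipticCurves.SatisfiesHeegnerHypothesis N' K) (hodd : Odd (NumberField.discr K))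
    (κ : Literature.NumberTheory.EllipticCurves.ZpExtension K 3) (hκ : κ.IsAnticyclotomic)
    (γ : Field.absoluteGaloisGroup K) [Fact (κ.IsTopGenerator γ)]
    (𝔭 : IsDedekindDomain.HeightOneSpectrum (NumberField.RingOfIntegers K))
    (h𝔭 : ((3 : ℕ) : NumberField.RingOfIntegers K) ∈ 𝔭.asIdeal)
    (he : 𝔭.asIdeal.ramificationIdx (NumberField.RingOfIntegers ℚ) = 1)
    (hf : 𝔭.asIdeal.inertiaDeg (NumberField.RingOfIntegers ℚ) = 1)
    (𝔭' : IsDedekindDomain.HeightOneSpectrum (NumberField.RingOfIntegers K))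
    (h𝔭' : ((3 : ℕ) : NumberField.RingOfIntegers K) ∈ 𝔭'.asIdeal) (hne : 𝔭' ≠ 𝔭)
    (ι' : PadicAlgCl 3 ≃+* ℂ)
    (hι : Summit.BirchSwinnertonDyer.BirchSwinnertonDyer.Theorems.SchneiderFree.BranchInducesPrime 3 ι' 𝔭)
    (ΩK : ℂ) (Ωp : ℂ_[3]) (L' : Literature.NumberTheory.EllipticCurves.UnrSeries 3) (hΩK : ΩK ≠ 0) (hΩp : Ωp ≠ 0)
    (hL : Literature.NumberTheory.EllipticCurves.IsBDPLFunction ι' 𝔭 κ γ Dt'.f ΩK Ωp L')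
    (hμ : ∃ i : ℕ, ‖((PowerSeries.coeff i L' : unrIntegers 3) : ℂ_[3])‖ = 1) :
    BoundedCharLayers (Summit.BirchSwinnertonDyer.Rank1Residual.X11b.AcSelmer.XAc (W'.baseChange K) 3 κ 𝔭' ∅ γ) := by
  obtain ⟨B, m₀, hB⟩ := hK W' N' K Dt' hbucket hsurj hN hK' hH hodd κ hκ γ 𝔭 h𝔭 he hf 𝔭' h𝔭' hne ι' hι ΩK Ωp L'
    hΩK hΩp hL
  obtain ⟨lam, m₁, hlam⟩ := hP1 L' hμ
  refine ⟨B + lam, max (max m₀ m₁) 1, fun m hm ↦ ?_⟩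
  have hm₀ : m₀ ≤ m := le_trans (le_trans (le_max_left _ _) (le_max_left _ _)) hm
  have hm₁ : m₁ ≤ m := le_trans (le_trans (le_max_right _ _) (le_max_left _ _)) hm
  have hm1 : 1 ≤ m := le_trans (le_max_right _ _) hm
  obtain ⟨ζ, hζ⟩ := hroots m hm1
  obtain ⟨v, hv⟩ := hval L' m hm1 ζ hζ
  have hvne : v ≠ 0 := by
    intro h0
    have hn := hlam m hm₁ ζ hζ v hv
    rw [h0, norm_zero] at hn
    have hz : ‖ζ - 1‖ ≠ 0 := by
      intro hz
      have h3 := hP0 m hm1 ζ hζ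
      rw [hz, zero_pow (Nat.totient_pos.2 (pow_pos (by norm_num) m)).ne'] at h3
      norm_num at h3
    exact (pow_ne_zero lam hz) hn.symm
  obtain ⟨hfin, hineq⟩ := hB m hm₀ ζ hζ v hv hvne
  exact ⟨hfin, card_le_of_onePoint hineq (hlam m hm₁ ζ hζ v hv) (hP0 m hm1 ζ hζ)⟩

/-! ### §5 P2 PROVED: bounded character layers ⟹ `X/3X` finite (Nakayama over `Λ/3 = 𝔽₃⟦T⟧`) -/

/-- `Φ_{3^m}(1+T) ≡ T^{2·3^{m-1}} (mod 3)` in `Λ` (`m ≥ 1`). -/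
theorem cycLayer_eq_X_pow_add (m : ℕ) (hm : 1 ≤ m) :
    ∃ u : IwasawaAlgebra 3, cycLayer m = PowerSeries.X ^ (2 * 3 ^ (m - 1)) + 3 * u := by
  have h3 : Nat.Prime 3 := Nat.prime_three
  obtain ⟨r, hr⟩ : ∃ r : IwasawaAlgebra 3,
      (1 + PowerSeries.X) ^ 3 ^ (m - 1) = 1 + PowerSeries.X ^ 3 ^ (m - 1) + 3 * r := by
    refine ⟨1 * PowerSeries.X * ∑ k ∈ Finset.Ioo 0 (3 ^ (m - 1)),
      (1 : IwasawaAlgebra 3) ^ (k - 1) * PowerSeries.X ^ (3 ^ (m - 1) - k - 1) *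
        (((3 ^ (m - 1)).choose k / 3 : ℕ) : IwasawaAlgebra 3), ?_⟩
    have := add_pow_prime_pow_eq h3 (1 : IwasawaAlgebra 3) PowerSeries.X (m - 1)
    rw [this, one_pow]
    push_cast
    ring
  refine ⟨1 + PowerSeries.X ^ 3 ^ (m - 1) + 3 * r + 3 * r ^ 2 + 2 * PowerSeries.X ^ 3 ^ (m - 1) * r, ?_⟩
  unfold cycLayer
  simp only [Finset.sum_range_succ, Finset.sum_range_zero, zero_mul, pow_zero, one_mul, zero_add]
  rw [show 2 * 3 ^ (m - 1) = 3 ^ (m - 1) * 2 from by ring, pow_mul, pow_mul, hr]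
  ring

/-- The ideals `(T^n, 3) ⊂ Λ`. -/
def layerIdeal (n : ℕ) : Ideal (IwasawaAlgebra 3) := Ideal.span {PowerSeries.X ^ n, 3}

theorem span_cycLayer_le (m : ℕ) (hm : 1 ≤ m) :
    Ideal.span {cycLayer m} ≤ layerIdeal (2 * 3 ^ (m - 1)) := by
  obtain ⟨u, hu⟩ := cycLayer_eq_X_pow_add m hm
  rw [Ideal.span_singleton_le_iff_mem, hu]
  exact Ideal.add_mem _ (Ideal.subset_span (by simp))
    (Ideal.mul_mem_right _ _ (Ideal.subset_span (by simp [layerIdeal])))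

theorem layerIdeal_anti {n N : ℕ} (h : n ≤ N) : layerIdeal N ≤ layerIdeal n := by
  unfold layerIdeal
  rw [Ideal.span_le]
  rintro x hx
  simp only [Set.mem_insert_iff, Set.mem_singleton_iff] at hx
  rcases hx with rfl | rfl
  · rw [show N = (N - n) + n from (Nat.sub_add_cancel h).symm, pow_add]
    exact Ideal.mul_mem_left _ _ (Ideal.subset_span (by simp))
  · exact Ideal.subset_span (by simp)

theorem three_mem_layerIdeal (n : ℕ) : (3 : IwasawaAlgebra 3) ∈ layerIdeal n :=
  Ideal.subset_span (by simp [layerIdeal])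

theorem X_pow_mem_layerIdeal (n : ℕ) : (PowerSeries.X ^ n : IwasawaAlgebra 3) ∈ layerIdeal n :=
  Ideal.subset_span (by simp [layerIdeal])

section ModuleGeneric

variable {A : Type*} [CommRing A] {X : Type*} [AddCommGroup X] [Module A X]

theorem finite_quot_of_le {I J : Ideal A} (h : I ≤ J) (hf : Finite (X ⧸ (I • (⊤ : Submodule A X)))) :
    Finite (X ⧸ (J • (⊤ : Submodule A X))) ∧
      Nat.card (X ⧸ (J • (⊤ : Submodule A X))) ≤ Nat.card (X ⧸ (I • (⊤ : Submodule A X))) := by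
  have hle : I • (⊤ : Submodule A X) ≤ J • ⊤ := Submodule.smul_mono_left h
  haveI := hf
  exact ⟨Finite.of_surjective _ (Submodule.factor_surjective hle),
    Nat.card_le_card_of_surjective _ (Submodule.factor_surjective hle)⟩

/-- Equal finite cardinalities of nested quotients force equality of the submodules. -/
theorem le_of_card_quot_le {p p' : Submodule A X} (h : p ≤ p') [Finite (X ⧸ p)]
    (hc : Nat.card (X ⧸ p) ≤ Nat.card (X ⧸ p')) : p' ≤ p := by
  have hbij := (Submodule.factor_surjective h).bijective_of_nat_card_le hc
  intro x hx
  have h0 : Submodule.factor h (Submodule.Quotient.mk x) = 0 := by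
    change Submodule.mapQ p p' LinearMap.id h (Submodule.Quotient.mk x) = 0
    rw [Submodule.mapQ_apply, LinearMap.id_apply]
    exact (Submodule.Quotient.mk_eq_zero p').2 hx
  have := hbij.1 (h0.trans (map_zero _).symm)
  exact (Submodule.Quotient.mk_eq_zero p).1 this

/-- Membership in `(a, b) • ⊤`. -/
theorem mem_span_pair_smul_top {a b : A} {x : X} (hx : x ∈ Ideal.span {a, b} • (⊤ : Submodule A X)) :
    ∃ w w' : X, x = a • w + b • w' := by
  have hsplit : Ideal.span ({a, b} : Set A) = Ideal.span {a} ⊔ Ideal.span {b} := by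
    rw [Set.insert_eq, Ideal.span_union]
  rw [hsplit, Submodule.sup_smul, Submodule.mem_sup] at hx
  obtain ⟨y, hy, z, hz, rfl⟩ := hx
  rw [Submodule.ideal_span_singleton_smul, Submodule.mem_smul_pointwise_iff_exists] at hy hz
  obtain ⟨w, -, rfl⟩ := hy
  obtain ⟨w', -, rfl⟩ := hz
  exact ⟨w, w', rfl⟩

end ModuleGeneric

theorem exists_succ_le_of_bounded (f : ℕ → ℕ) (B : ℕ) (hB : ∀ n, f n ≤ B) : ∃ n, f (n + 1) ≤ f n := by
  by_contra h
  push_neg at h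
  have key : ∀ n, n ≤ f n := by
    intro n
    induction n with
    | zero => exact Nat.zero_le _
    | succ k ih => exact Nat.succ_le_of_lt (lt_of_le_of_lt ih (h k))
  have := key (B + 1)
  have := hB (B + 1)
  omega

theorem X_not_isUnit : ¬ IsUnit (PowerSeries.X : IwasawaAlgebra 3) := by
  intro h
  have h0 := h.map (PowerSeries.constantCoeff (R := ℤ_[3]))
  rw [PowerSeries.constantCoeff_X, isUnit_zero_iff] at h0
  exact zero_ne_one h0

theorem span_X_le_jacobson_bot :
    Ideal.span {(PowerSeries.X : IwasawaAlgebra 3)} ≤ (⊥ : Ideal (IwasawaAlgebra 3)).jacobson := by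
  refine le_trans ?_ (IsLocalRing.maximalIdeal_le_jacobson ⊥)
  rw [Ideal.span_singleton_le_iff_mem]
  exact (IsLocalRing.mem_maximalIdeal _).2 X_not_isUnit

/-- **P2 PROVED.** -/
theorem boundedCharLayersCriterion_holds : BoundedCharLayersCriterion := by
  intro X _ _ _ hX
  obtain ⟨B, m₀, hB⟩ := hX
  -- every `(T^n, 3)`-layer is finite of order ≤ 3^B
  have hQ : ∀ n : ℕ, Finite (X ⧸ (layerIdeal n • (⊤ : Submodule (IwasawaAlgebra 3) X))) ∧
      Nat.card (X ⧸ (layerIdeal n • (⊤ : Submodule (IwasawaAlgebra 3) X))) ≤ 3 ^ B := by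
    intro n
    have hm₀ : m₀ ≤ max m₀ (n + 1) := le_max_left _ _
    have hm1 : 1 ≤ max m₀ (n + 1) := le_trans (by omega) (le_max_right _ _)
    have hnN : n ≤ 2 * 3 ^ (max m₀ (n + 1) - 1) := by
      have h1 : max m₀ (n + 1) - 1 < 3 ^ (max m₀ (n + 1) - 1) := Nat.lt_pow_self (by norm_num)
      have h2 : n + 1 ≤ max m₀ (n + 1) := le_max_right _ _
      omega
    obtain ⟨hfin, hcard⟩ := hB (max m₀ (n + 1)) hm₀
    have hle : Ideal.span {cycLayer (max m₀ (n + 1))} ≤ layerIdeal n :=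
      (span_cycLayer_le _ hm1).trans (layerIdeal_anti hnN)
    obtain ⟨hf, hc⟩ := finite_quot_of_le (X := X) hle hfin
    exact ⟨hf, hc.trans hcard⟩
  -- the orders stabilise: `(T^n,3)X = (T^{n+1},3)X` for some `n`
  obtain ⟨n, hn⟩ := exists_succ_le_of_bounded
    (fun n => Nat.card (X ⧸ (layerIdeal n • (⊤ : Submodule (IwasawaAlgebra 3) X)))) (3 ^ B) (fun n => (hQ n).2)
  have hle : layerIdeal (n + 1) • (⊤ : Submodule (IwasawaAlgebra 3) X) ≤ layerIdeal n • ⊤ :=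
    Submodule.smul_mono_left (layerIdeal_anti (Nat.le_succ n))
  haveI := (hQ (n + 1)).1
  have hge : layerIdeal n • (⊤ : Submodule (IwasawaAlgebra 3) X) ≤ layerIdeal (n + 1) • ⊤ :=
    le_of_card_quot_le hle hn
  -- Nakayama in `Y = X/3X` for `N = T^n Y`
  set P3 : Submodule (IwasawaAlgebra 3) X := Ideal.span {(3 : IwasawaAlgebra 3)} • ⊤ with hP3
  set N : Submodule (IwasawaAlgebra 3) (X ⧸ P3) :=
    Ideal.span {(PowerSeries.X ^ n : IwasawaAlgebra 3)} • ⊤ with hN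
  have hXn : ∀ x : X, ∃ w w' : X, (PowerSeries.X ^ n : IwasawaAlgebra 3) • x =
      (PowerSeries.X ^ (n + 1) : IwasawaAlgebra 3) • w + (3 : IwasawaAlgebra 3) • w' := by
    intro x
    have hx : (PowerSeries.X ^ n : IwasawaAlgebra 3) • x ∈ layerIdeal (n + 1) • (⊤ : Submodule _ X) :=
      hge (Submodule.smul_mem_smul (X_pow_mem_layerIdeal n) Submodule.mem_top)
    exact mem_span_pair_smul_top hx
  have hNle : N ≤ Ideal.span {(PowerSeries.X : IwasawaAlgebra 3)} • N := by
    rw [hN, Submodule.smul_le]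
    intro r hr y _
    obtain ⟨a, rfl⟩ := Ideal.mem_span_singleton'.1 hr
    rw [mul_smul]
    refine Submodule.smul_mem _ a ?_
    induction y using Submodule.Quotient.induction_on with
    | H x =>
      obtain ⟨w, w', hw⟩ := hXn x
      rw [← Submodule.Quotient.mk_smul, hw, Submodule.Quotient.mk_add, Submodule.Quotient.mk_smul,
        Submodule.Quotient.mk_smul]
      have h3w : (Submodule.Quotient.mk ((3 : IwasawaAlgebra 3) • w') : X ⧸ P3) = 0 := by
        rw [Submodule.Quotient.mk_eq_zero, hP3]
        exact Submodule.smul_mem_smul (Ideal.subset_span rfl) Submodule.mem_top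
      rw [Submodule.Quotient.mk_smul] at h3w
      rw [h3w, add_zero, pow_succ, mul_comm, mul_smul]
      exact Submodule.smul_mem_smul (Ideal.subset_span rfl)
        (Submodule.smul_mem_smul (Ideal.subset_span rfl) Submodule.mem_top)
  have hNfg : N.FG := by
    haveI : IsNoetherian (IwasawaAlgebra 3) (X ⧸ P3) := isNoetherian_of_isNoetherianRing_of_finite _ _
    exact IsNoetherian.noetherian N
  have hN0 : N = ⊥ := Submodule.eq_bot_of_le_smul_of_le_jacobson_bot _ N hNfg hNle span_X_le_jacobson_bot
  -- hence `T^n X ⊆ 3X`, so `(T^n,3)X = 3X` and `X/3X` is the finite layer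
  have hXn3 : ∀ x : X, (PowerSeries.X ^ n : IwasawaAlgebra 3) • x ∈ P3 := by
    intro x
    have : (Submodule.Quotient.mk ((PowerSeries.X ^ n : IwasawaAlgebra 3) • x) : X ⧸ P3) ∈ N := by
      rw [Submodule.Quotient.mk_smul, hN]
      exact Submodule.smul_mem_smul (Ideal.subset_span rfl) Submodule.mem_top
    rw [hN0, Submodule.mem_bot] at this
    exact (Submodule.Quotient.mk_eq_zero P3).1 this
  have hEq : layerIdeal n • (⊤ : Submodule (IwasawaAlgebra 3) X) = P3 := by
    apply le_antisymm
    · rw [Submodule.smul_le]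
      intro r hr x _
      obtain ⟨a, b, rfl⟩ := Ideal.mem_span_pair.1 hr
      rw [add_smul, mul_smul, mul_smul]
      exact P3.add_mem (P3.smul_mem a (hXn3 x))
        (P3.smul_mem b (Submodule.smul_mem_smul (Ideal.subset_span rfl) Submodule.mem_top))
    · exact Submodule.smul_mono_left
        ((Ideal.span_singleton_le_iff_mem _).2 (three_mem_layerIdeal n))
  have hC : (PowerSeries.C ((3 : ℕ) : ℤ_[3]) : IwasawaAlgebra 3) = 3 := by
    rw [map_natCast, Nat.cast_ofNat]
  change Finite (X ⧸ (Ideal.span {PowerSeries.C ((3 : ℕ) : ℤ_[3])} • (⊤ : Submodule (IwasawaAlgebra 3) X)))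
  rw [hC, ← hP3, ← hEq]
  exact (hQ n).1

/-- **COROLLARY (PROVED): the endgame is unconditional in P2.** -/
theorem conclusion_of_boundedCharLayers' {K : Type} [Field K] [NumberField K] (W : WeierstrassCurve K)
    [W.IsElliptic] (κ : ZpExtension K 3) (𝔭 : HeightOneSpectrum (𝓞 K)) (γ : absoluteGaloisGroup K)
    [Fact (κ.IsTopGenerator γ)] (hX : BoundedCharLayers (XAc W 3 κ 𝔭 ∅ γ)) :
    Module.IsTorsion (IwasawaAlgebra 3) (XAc W 3 κ 𝔭 ∅ γ) ∧
      ∃ g : UnrSeries 3,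
        (XAc.charIdeal W 3 κ 𝔭 ∅ γ).map (PowerSeries.map (Halves.toUnr 3)) = Ideal.span {g} ∧
          ∃ i : ℕ, ‖((PowerSeries.coeff i g : unrIntegers 3) : ℂ_[3])‖ = 1 :=
  conclusion_of_boundedCharLayers boundedCharLayersCriterion_holds W κ 𝔭 γ hX

/-! ### §6 P0 PROVED and the two existence side conditions of the squeeze discharged -/

theorem norm_three_padicComplex : ‖((3 : ℕ) : ℂ_[3])‖ = (3 : ℝ)⁻¹ := by
  rw [← PadicComplex.coe_natCast, PadicComplex.norm_extends,
    ← map_natCast (algebraMap ℚ_[3] (PadicAlgCl 3)), PadicAlgCl.norm_extends, Padic.norm_p]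
  norm_num

theorem norm_eq_one_of_isPrimitiveRoot {m : ℕ} {ζ : ℂ_[3]} (hζ : IsPrimitiveRoot ζ (3 ^ m)) : ‖ζ‖ = 1 := by
  have h := congrArg norm hζ.pow_eq_one
  rw [norm_pow, norm_one] at h
  exact (pow_eq_one_iff_of_nonneg (norm_nonneg ζ) (pow_ne_zero m (by norm_num))).1 h

theorem norm_pow_sub_one_le {ζ : ℂ_[3]} (hζ : ‖ζ‖ = 1) (a : ℕ) : ‖ζ ^ a - 1‖ ≤ ‖ζ - 1‖ := by
  rw [← geom_sum_mul, norm_mul]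
  have h1 : ‖∑ i ∈ Finset.range a, ζ ^ i‖ ≤ 1 :=
    IsUltrametricDist.norm_sum_le_of_forall_le_of_nonneg zero_le_one
      (fun i _ => by rw [norm_pow, hζ, one_pow])
  calc ‖∑ i ∈ Finset.range a, ζ ^ i‖ * ‖ζ - 1‖ ≤ 1 * ‖ζ - 1‖ := by gcongr
    _ = ‖ζ - 1‖ := one_mul _

/-- All primitive `3^m`-th roots of unity are equidistant from `1` (elementary: `(ζ^a − 1)/(ζ − 1)` is integral). -/
theorem norm_sub_one_eq_of_isPrimitiveRoot {m : ℕ} {ζ μ : ℂ_[3]} (hζ : IsPrimitiveRoot ζ (3 ^ m))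
    (hμ : IsPrimitiveRoot μ (3 ^ m)) : ‖μ - 1‖ = ‖ζ - 1‖ := by
  haveI : NeZero (3 ^ m) := ⟨pow_ne_zero m (by norm_num)⟩
  obtain ⟨a, -, rfl⟩ := hζ.eq_pow_of_pow_eq_one hμ.pow_eq_one
  apply le_antisymm (norm_pow_sub_one_le (norm_eq_one_of_isPrimitiveRoot hζ) a)
  obtain ⟨b, -, hb⟩ := hμ.eq_pow_of_pow_eq_one hζ.pow_eq_one
  calc ‖ζ - 1‖ = ‖(ζ ^ a) ^ b - 1‖ := by rw [hb]
    _ ≤ ‖ζ ^ a - 1‖ := norm_pow_sub_one_le (norm_eq_one_of_isPrimitiveRoot hμ) b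

/-- **P0 PROVED**: `‖ζ − 1‖^{φ(3^m)} = 3⁻¹` (`∏_{μ primitive} (1 − μ) = Φ_{3^m}(1) = 3`). -/
theorem primitiveRootNormAtThree_holds : PrimitiveRootNormAtThree := by
  intro m hm ζ hζ
  obtain ⟨k, rfl⟩ : ∃ k, m = k + 1 := ⟨m - 1, by omega⟩
  have hprod := Polynomial.eval_one_cyclotomic_prime_pow (R := ℂ_[3]) (p := 3) k
  rw [Polynomial.cyclotomic_eq_prod_X_sub_primitiveRoots hζ, Polynomial.eval_prod] at hprod
  simp only [Polynomial.eval_sub, Polynomial.eval_X, Polynomial.eval_C] at hprod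
  have hnorm := congrArg norm hprod
  have hpos : 0 < 3 ^ (k + 1) := pow_pos (by norm_num) _
  rw [norm_prod, Finset.prod_congr rfl (fun μ hμ => by
      rw [norm_sub_rev, norm_sub_one_eq_of_isPrimitiveRoot hζ ((mem_primitiveRoots hpos).1 hμ)]),
    Finset.prod_const, hζ.card_primitiveRoots, norm_three_padicComplex] at hnorm
  exact hnorm

/-- Primitive `3^m`-th roots of unity exist in `ℂ₃` (via the algebraic closure `PadicAlgCl 3`). -/
theorem exists_isPrimitiveRoot_padicComplex (m : ℕ) : ∃ ζ : ℂ_[3], IsPrimitiveRoot ζ (3 ^ m) := by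
  have hpos : 0 < 3 ^ m := pow_pos (by norm_num) m
  haveI : NeZero (3 ^ m) := ⟨hpos.ne'⟩
  have hdeg : (Polynomial.cyclotomic (3 ^ m) (PadicAlgCl 3)).degree ≠ 0 := by
    rw [Polynomial.degree_cyclotomic]
    exact_mod_cast (Nat.totient_pos.2 hpos).ne'
  obtain ⟨μ, hμ⟩ := IsAlgClosed.exists_root _ hdeg
  rw [Polynomial.isRoot_cyclotomic_iff] at hμ
  exact ⟨(μ : ℂ_[3]), hμ.map_of_injective
    (f := (UniformSpace.Completion.coeRingHom : PadicAlgCl 3 →+* ℂ_[3]))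
    (UniformSpace.Completion.coeRingHom : PadicAlgCl 3 →+* ℂ_[3]).injective⟩

/-- The closed unit ball of `ℂ₃` as a subring (ultrametric inequality). -/
def unitBallSubring : Subring ℂ_[3] where
  carrier := {x | ‖x‖ ≤ 1}
  mul_mem' {a b} ha hb := by
    simp only [Set.mem_setOf_eq] at *
    rw [norm_mul]; exact mul_le_one₀ ha (norm_nonneg _) hb
  one_mem' := by simp
  add_mem' {a b} ha hb := by
    simp only [Set.mem_setOf_eq] at *
    exact (IsUltrametricDist.norm_add_le_max a b).trans (max_le ha hb)
  zero_mem' := by simp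
  neg_mem' {a} ha := by simpa using ha

/-- `R₀ ⊂ 𝓞_{ℂ₃}`: every element of `unrIntegers 3` has norm `≤ 1`. -/
theorem norm_le_one_of_mem_unrIntegers {c : ℂ_[3]} (hc : c ∈ unrIntegers 3) : ‖c‖ ≤ 1 := by
  have hcl : Subring.closure {ζ : ℂ_[3] | ∃ m : ℕ, 0 < m ∧ ¬ 3 ∣ m ∧ ζ ^ m = 1} ≤ unitBallSubring := by
    rw [Subring.closure_le]
    rintro ζ ⟨m, hm, -, hζ⟩
    have h := congrArg norm hζ
    rw [norm_pow, norm_one] at h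
    show ‖ζ‖ ≤ 1
    exact ((pow_eq_one_iff_of_nonneg (norm_nonneg ζ) hm.ne').1 h).le
  have hclosed : IsClosed (unitBallSubring : Set ℂ_[3]) := by
    show IsClosed {x : ℂ_[3] | ‖x‖ ≤ 1}
    exact isClosed_le continuous_norm continuous_const
  exact (Subring.topologicalClosure_minimal _ hcl hclosed) hc

/-- `HasValueAt` is total on the open unit disc: the series converges (geometric majorant). -/
theorem exists_hasValueAt (L : UnrSeries 3) {x : ℂ_[3]} (hx : ‖x‖ < 1) : ∃ v, L.HasValueAt x v := by
  have hsum : Summable (fun k : ℕ ↦ ((PowerSeries.coeff k L : unrIntegers 3) : ℂ_[3]) * x ^ k) := by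
    refine Summable.of_norm_bounded (g := fun k : ℕ ↦ ‖x‖ ^ k)
      (summable_geometric_of_lt_one (norm_nonneg x) hx) (fun k ↦ ?_)
    rw [norm_mul, norm_pow]
    calc ‖((PowerSeries.coeff k L : unrIntegers 3) : ℂ_[3])‖ * ‖x‖ ^ k ≤ 1 * ‖x‖ ^ k := by
          gcongr; exact norm_le_one_of_mem_unrIntegers (SetLike.coe_mem _)
      _ = ‖x‖ ^ k := one_mul _
  exact ⟨_, hsum.hasSum⟩

/-- **THE SQUEEZE, FINAL FORM (PROVED): only K1 (`C⁺`), P1 (unit coefficient ⟹ unit-disc values of size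
`‖ζ−1‖^λ`) and the analytic `μ = 0` of a BDP frame remain as hypotheses; conclusion = the crux's conclusion
for that datum.** -/
theorem twinAlgMuZero_conclusion_of_squeeze (hK : TwistedOnePointKolyvaginAtThree)
    (hP1 : UnitCoeffValuesAtTorsionPoints)
    (W' : WeierstrassCurve ℚ) [W'.IsElliptic] [W'.IsGloballyMinimal] (N' : ℕ) [NeZero N'] (K : Type) [Field K]
    [NumberField K] (Dt' : Literature.NumberTheory.EllipticCurves.ModularForms.ModularParametrizationData W' N')
    (hbucket : Literature.NumberTheory.EllipticCurves.Rank1Residual.Mult W' 3 ∧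
        ¬ 3 ∣ padicValInt 3 W'.minimalDiscriminantInt ∨
      Literature.NumberTheory.EllipticCurves.Rank1Residual.GoodSS W' 3 ∧ W'.frobeniusTrace 3 = 0)
    (hsurj : W'.HasSurjectiveModNGaloisRep 3) (hN : W'.conductorNorm ℤ = N')
    (hK' : Literature.NumberTheory.EllipticCurves.IsImaginaryQuadratic K)
    (hH : Literature.NumberTheory.EllipticCurves.SatisfiesHeegnerHypothesis N' K) (hodd : Odd (NumberField.discr K))
    (κ : Literature.NumberTheory.EllipticCurves.ZpExtension K 3) (hκ : κ.IsAnticyclotomic)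
    (γ : Field.absoluteGaloisGroup K) [Fact (κ.IsTopGenerator γ)]
    (𝔭 : IsDedekindDomain.HeightOneSpectrum (NumberField.RingOfIntegers K))
    (h𝔭 : ((3 : ℕ) : NumberField.RingOfIntegers K) ∈ 𝔭.asIdeal)
    (he : 𝔭.asIdeal.ramificationIdx (NumberField.RingOfIntegers ℚ) = 1)
    (hf : 𝔭.asIdeal.inertiaDeg (NumberField.RingOfIntegers ℚ) = 1)
    (𝔭' : IsDedekindDomain.HeightOneSpectrum (NumberField.RingOfIntegers K))
    (h𝔭' : ((3 : ℕ) : NumberField.RingOfIntegers K) ∈ 𝔭'.asIdeal) (hne : 𝔭' ≠ 𝔭)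
    (ι' : PadicAlgCl 3 ≃+* ℂ)
    (hι : Summit.BirchSwinnertonDyer.BirchSwinnertonDyer.Theorems.SchneiderFree.BranchInducesPrime 3 ι' 𝔭)
    (ΩK : ℂ) (Ωp : ℂ_[3]) (L' : Literature.NumberTheory.EllipticCurves.UnrSeries 3) (hΩK : ΩK ≠ 0) (hΩp : Ωp ≠ 0)
    (hL : Literature.NumberTheory.EllipticCurves.IsBDPLFunction ι' 𝔭 κ γ Dt'.f ΩK Ωp L')
    (hμ : ∃ i : ℕ, ‖((PowerSeries.coeff i L' : unrIntegers 3) : ℂ_[3])‖ = 1) :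
    Module.IsTorsion (IwasawaAlgebra 3)
        (Summit.BirchSwinnertonDyer.Rank1Residual.X11b.AcSelmer.XAc (W'.baseChange K) 3 κ 𝔭' ∅ γ) ∧
      ∃ g' : UnrSeries 3,
        (Summit.BirchSwinnertonDyer.Rank1Residual.X11b.AcSelmer.XAc.charIdeal (W'.baseChange K) 3 κ 𝔭' ∅ γ).map
            (PowerSeries.map (Summit.BirchSwinnertonDyer.Rank1Residual.X11b.Halves.toUnr 3)) = Ideal.span {g'} ∧
          ∃ i : ℕ, ‖((PowerSeries.coeff i g' : unrIntegers 3) : ℂ_[3])‖ = 1 := by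
  have hroots : ∀ m : ℕ, 1 ≤ m → ∃ ζ : ℂ_[3], IsPrimitiveRoot ζ (3 ^ m) :=
    fun m _ ↦ exists_isPrimitiveRoot_padicComplex m
  have hval : ∀ (L : UnrSeries 3) (m : ℕ), 1 ≤ m → ∀ ζ : ℂ_[3], IsPrimitiveRoot ζ (3 ^ m) →
      ∃ v, L.HasValueAt (ζ - 1) v := by
    intro L m hm ζ hζ
    refine exists_hasValueAt L ?_
    -- ‖ζ - 1‖ ^ φ(3^m) = 3⁻¹ < 1 with φ(3^m) ≥ 1 forces ‖ζ - 1‖ < 1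
    have hφ := primitiveRootNormAtThree_holds m hm ζ hζ
    by_contra hge
    push_neg at hge
    have : (1 : ℝ) ≤ ‖ζ - 1‖ ^ Nat.totient (3 ^ m) := one_le_pow₀ hge
    rw [hφ] at this
    norm_num at this
  exact conclusion_of_boundedCharLayers' (W'.baseChange K) κ 𝔭' γ
    (boundedCharLayers_of_squeeze hK hP1 primitiveRootNormAtThree_holds hroots hval W' N' K Dt' hbucket hsurj hN
      hK' hH hodd κ hκ γ 𝔭 h𝔭 he hf 𝔭' h𝔭' hne ι' hι ΩK Ωp L' hΩK hΩp hL hμ)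

/-! ### §7 P1 PROVED (elementary ultrametric estimate — no Weierstrass preparation, no discreteness of `R₀`) -/

theorem unitCoeffValuesAtTorsionPoints_holds : UnitCoeffValuesAtTorsionPoints := by
  intro L hex
  classical
  have hc1 : ∀ k, ‖((PowerSeries.coeff k L : unrIntegers 3) : ℂ_[3])‖ ≤ 1 :=
    fun k ↦ norm_le_one_of_mem_unrIntegers (SetLike.coe_mem _)
  -- λ = least index of a unit coefficient
  obtain ⟨lam, hlam, hmin⟩ : ∃ lam : ℕ, ‖((PowerSeries.coeff lam L : unrIntegers 3) : ℂ_[3])‖ = 1 ∧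
      ∀ k, k < lam → ‖((PowerSeries.coeff k L : unrIntegers 3) : ℂ_[3])‖ ≠ 1 :=
    ⟨Nat.find hex, Nat.find_spec hex, fun k hk ↦ Nat.find_min hex hk⟩
  have hlt : ∀ k, k < lam → ‖((PowerSeries.coeff k L : unrIntegers 3) : ℂ_[3])‖ < 1 :=
    fun k hk ↦ lt_of_le_of_ne (hc1 k) (hmin k hk)
  -- δ = a common bound < 1 for the earlier coefficients
  obtain ⟨δ, hδ0, hδ1, hδk⟩ : ∃ δ : ℝ, 0 ≤ δ ∧ δ < 1 ∧
      ∀ k, k < lam → ‖((PowerSeries.coeff k L : unrIntegers 3) : ℂ_[3])‖ ≤ δ := by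
    refine ⟨((Finset.range lam).sup (fun k ↦ ‖((PowerSeries.coeff k L : unrIntegers 3) : ℂ_[3])‖₊) : NNReal),
      NNReal.coe_nonneg _, ?_, ?_⟩
    · have : (Finset.range lam).sup (fun k ↦ ‖((PowerSeries.coeff k L : unrIntegers 3) : ℂ_[3])‖₊) < 1 := by
        rw [Finset.sup_lt_iff (by simp)]
        intro k hk
        have h := hlt k (Finset.mem_range.1 hk)
        rw [← coe_nnnorm] at h
        exact_mod_cast h
      exact_mod_cast this
    · intro k hk
      have h : ‖((PowerSeries.coeff k L : unrIntegers 3) : ℂ_[3])‖₊ ≤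
          (Finset.range lam).sup (fun k ↦ ‖((PowerSeries.coeff k L : unrIntegers 3) : ℂ_[3])‖₊) :=
        Finset.le_sup (f := fun k ↦ ‖((PowerSeries.coeff k L : unrIntegers 3) : ℂ_[3])‖₊) (Finset.mem_range.2 hk)
      rw [← coe_nnnorm]
      exact_mod_cast h
  -- choose n₀ with δ^{n₀} < 3^{-λ}; m₀ := max n₀ 1
  obtain ⟨n₀, hn₀⟩ : ∃ n₀ : ℕ, δ ^ n₀ < ((3 : ℝ)⁻¹) ^ lam :=
    exists_pow_lt_of_lt_one (pow_pos (by norm_num) lam) hδ1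
  refine ⟨lam, max n₀ 1, fun m hm ζ hζ v hv ↦ ?_⟩
  have hm1 : 1 ≤ m := le_trans (le_max_right _ _) hm
  have hn₀m : n₀ ≤ Nat.totient (3 ^ m) := by
    have h1 : n₀ ≤ m := le_trans (le_max_left _ _) hm
    rw [Nat.totient_prime_pow Nat.prime_three (by omega)]
    have h2 : m - 1 < 3 ^ (m - 1) := Nat.lt_pow_self (by norm_num)
    omega
  -- ρ = ‖ζ − 1‖ : ρ^φ = 3⁻¹, 0 < ρ < 1
  have hρφ : ‖ζ - 1‖ ^ Nat.totient (3 ^ m) = (3 : ℝ)⁻¹ := primitiveRootNormAtThree_holds m hm1 ζ hζ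
  have hρ0 : 0 ≤ ‖ζ - 1‖ := norm_nonneg _
  have hρ1 : ‖ζ - 1‖ < 1 := by
    by_contra hge
    push_neg at hge
    have : (1 : ℝ) ≤ ‖ζ - 1‖ ^ Nat.totient (3 ^ m) := one_le_pow₀ hge
    rw [hρφ] at this
    norm_num at this
  have hρpos : 0 < ‖ζ - 1‖ := by
    rcases hρ0.eq_or_lt with h | h
    · exfalso
      have hφpos : Nat.totient (3 ^ m) ≠ 0 := (Nat.totient_pos.2 (pow_pos (by norm_num) m)).ne'
      rw [← h, zero_pow hφpos] at hρφ
      norm_num at hρφ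
    · exact h
  have hδρ : δ < ‖ζ - 1‖ ^ lam := by
    have h1 : δ ^ Nat.totient (3 ^ m) < (‖ζ - 1‖ ^ lam) ^ Nat.totient (3 ^ m) := by
      calc δ ^ Nat.totient (3 ^ m) ≤ δ ^ n₀ := pow_le_pow_of_le_one hδ0 hδ1.le hn₀m
        _ < ((3 : ℝ)⁻¹) ^ lam := hn₀
        _ = (‖ζ - 1‖ ^ lam) ^ Nat.totient (3 ^ m) := by rw [← pow_mul, mul_comm, pow_mul, hρφ]
    exact lt_of_pow_lt_pow_left₀ _ (by positivity) h1
  -- the terms: the λ-term has norm ρ^λ, every other term has norm ≤ η < ρ^λ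
  have htlam : ‖((PowerSeries.coeff lam L : unrIntegers 3) : ℂ_[3]) * (ζ - 1) ^ lam‖ = ‖ζ - 1‖ ^ lam := by
    rw [norm_mul, norm_pow, hlam, one_mul]
  have hηlt : max δ (‖ζ - 1‖ ^ (lam + 1)) < ‖ζ - 1‖ ^ lam :=
    max_lt hδρ (by rw [pow_succ]; exact mul_lt_of_lt_one_right (pow_pos hρpos _) hρ1)
  have hη0 : 0 ≤ max δ (‖ζ - 1‖ ^ (lam + 1)) := le_max_of_le_left hδ0
  have hother : ∀ k, k ≠ lam →
      ‖((PowerSeries.coeff k L : unrIntegers 3) : ℂ_[3]) * (ζ - 1) ^ k‖ ≤ max δ (‖ζ - 1‖ ^ (lam + 1)) := by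
    intro k hk
    rw [norm_mul, norm_pow]
    rcases lt_or_gt_of_ne hk with hk' | hk'
    · calc ‖((PowerSeries.coeff k L : unrIntegers 3) : ℂ_[3])‖ * ‖ζ - 1‖ ^ k ≤ δ * 1 :=
            mul_le_mul (hδk k hk') (pow_le_one₀ hρ0 hρ1.le) (by positivity) hδ0
        _ ≤ max δ (‖ζ - 1‖ ^ (lam + 1)) := by rw [mul_one]; exact le_max_left _ _
    · calc ‖((PowerSeries.coeff k L : unrIntegers 3) : ℂ_[3])‖ * ‖ζ - 1‖ ^ k ≤ 1 * ‖ζ - 1‖ ^ (lam + 1) :=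
            mul_le_mul (hc1 k) (pow_le_pow_of_le_one hρ0 hρ1.le (by omega)) (by positivity) zero_le_one
        _ ≤ max δ (‖ζ - 1‖ ^ (lam + 1)) := by rw [one_mul]; exact le_max_right _ _
  -- split the convergent sum into the λ-term and the rest
  have hv' : HasSum (fun k : ℕ ↦ ((PowerSeries.coeff k L : unrIntegers 3) : ℂ_[3]) * (ζ - 1) ^ k) v := hv
  have hsingle : HasSum (fun k : ℕ ↦ if k = lam then
      ((PowerSeries.coeff lam L : unrIntegers 3) : ℂ_[3]) * (ζ - 1) ^ lam else 0)
      (((PowerSeries.coeff lam L : unrIntegers 3) : ℂ_[3]) * (ζ - 1) ^ lam) := hasSum_ite_eq lam _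
  have hrest : HasSum (fun k : ℕ ↦ if k = lam then 0 else
      ((PowerSeries.coeff k L : unrIntegers 3) : ℂ_[3]) * (ζ - 1) ^ k)
      (v - ((PowerSeries.coeff lam L : unrIntegers 3) : ℂ_[3]) * (ζ - 1) ^ lam) := by
    have := hv'.sub hsingle
    have hfun : (fun k : ℕ ↦ if k = lam then (0 : ℂ_[3]) else
        ((PowerSeries.coeff k L : unrIntegers 3) : ℂ_[3]) * (ζ - 1) ^ k) =
        (fun b : ℕ ↦ ((PowerSeries.coeff b L : unrIntegers 3) : ℂ_[3]) * (ζ - 1) ^ b -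
          if b = lam then ((PowerSeries.coeff lam L : unrIntegers 3) : ℂ_[3]) * (ζ - 1) ^ lam else 0) := by
      ext k
      by_cases h : k = lam
      · subst h; simp
      · simp [h]
    rw [hfun]
    exact this
  have hrest_norm : ‖v - ((PowerSeries.coeff lam L : unrIntegers 3) : ℂ_[3]) * (ζ - 1) ^ lam‖ ≤
      max δ (‖ζ - 1‖ ^ (lam + 1)) := by
    rw [← hrest.tsum_eq]
    refine IsUltrametricDist.norm_tsum_le_of_forall_le_of_nonneg hη0 (fun k ↦ ?_)
    split_ifs with h
    · simpa using hη0
    · exact hother k h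
  have hne : ‖((PowerSeries.coeff lam L : unrIntegers 3) : ℂ_[3]) * (ζ - 1) ^ lam‖ ≠
      ‖v - ((PowerSeries.coeff lam L : unrIntegers 3) : ℂ_[3]) * (ζ - 1) ^ lam‖ := by
    rw [htlam]
    exact ne_of_gt (lt_of_le_of_lt hrest_norm hηlt)
  calc ‖v‖ = ‖((PowerSeries.coeff lam L : unrIntegers 3) : ℂ_[3]) * (ζ - 1) ^ lam +
        (v - ((PowerSeries.coeff lam L : unrIntegers 3) : ℂ_[3]) * (ζ - 1) ^ lam)‖ := by rw [add_sub_cancel]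
    _ = max ‖((PowerSeries.coeff lam L : unrIntegers 3) : ℂ_[3]) * (ζ - 1) ^ lam‖
        ‖v - ((PowerSeries.coeff lam L : unrIntegers 3) : ℂ_[3]) * (ζ - 1) ^ lam‖ :=
          IsUltrametricDist.norm_add_eq_max_of_norm_ne_norm hne
    _ = ‖ζ - 1‖ ^ lam := by
          rw [htlam]
          exact max_eq_left (le_of_lt (lt_of_le_of_lt hrest_norm hηlt))

/-- **THE SQUEEZE, UNCONDITIONAL FORM (PROVED): `C⁺ = TwistedOnePointKolyvaginAtThree` ALONE, plus the analytic
`μ = 0` of a BDP frame, gives the conclusion of `TwinAlgMuZeroAtThree` for that datum.** -/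
theorem twinAlgMuZero_conclusion_of_C_plus (hK : TwistedOnePointKolyvaginAtThree)
    (W' : WeierstrassCurve ℚ) [W'.IsElliptic] [W'.IsGloballyMinimal] (N' : ℕ) [NeZero N'] (K : Type) [Field K]
    [NumberField K] (Dt' : Literature.NumberTheory.EllipticCurves.ModularForms.ModularParametrizationData W' N')
    (hbucket : Literature.NumberTheory.EllipticCurves.Rank1Residual.Mult W' 3 ∧
        ¬ 3 ∣ padicValInt 3 W'.minimalDiscriminantInt ∨
      Literature.NumberTheory.EllipticCurves.Rank1Residual.GoodSS W' 3 ∧ W'.frobeniusTrace 3 = 0)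
    (hsurj : W'.HasSurjectiveModNGaloisRep 3) (hN : W'.conductorNorm ℤ = N')
    (hK' : Literature.NumberTheory.EllipticCurves.IsImaginaryQuadratic K)
    (hH : Literature.NumberTheory.EllipticCurves.SatisfiesHeegnerHypothesis N' K) (hodd : Odd (NumberField.discr K))
    (κ : Literature.NumberTheory.EllipticCurves.ZpExtension K 3) (hκ : κ.IsAnticyclotomic)
    (γ : Field.absoluteGaloisGroup K) [Fact (κ.IsTopGenerator γ)]
    (𝔭 : IsDedekindDomain.HeightOneSpectrum (NumberField.RingOfIntegers K))
    (h𝔭 : ((3 : ℕ) : NumberField.RingOfIntegers K) ∈ 𝔭.asIdeal)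
    (he : 𝔭.asIdeal.ramificationIdx (NumberField.RingOfIntegers ℚ) = 1)
    (hf : 𝔭.asIdeal.inertiaDeg (NumberField.RingOfIntegers ℚ) = 1)
    (𝔭' : IsDedekindDomain.HeightOneSpectrum (NumberField.RingOfIntegers K))
    (h𝔭' : ((3 : ℕ) : NumberField.RingOfIntegers K) ∈ 𝔭'.asIdeal) (hne : 𝔭' ≠ 𝔭)
    (ι' : PadicAlgCl 3 ≃+* ℂ)
    (hι : Summit.BirchSwinnertonDyer.BirchSwinnertonDyer.Theorems.SchneiderFree.BranchInducesPrime 3 ι' 𝔭)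
    (ΩK : ℂ) (Ωp : ℂ_[3]) (L' : Literature.NumberTheory.EllipticCurves.UnrSeries 3) (hΩK : ΩK ≠ 0) (hΩp : Ωp ≠ 0)
    (hL : Literature.NumberTheory.EllipticCurves.IsBDPLFunction ι' 𝔭 κ γ Dt'.f ΩK Ωp L')
    (hμ : ∃ i : ℕ, ‖((PowerSeries.coeff i L' : unrIntegers 3) : ℂ_[3])‖ = 1) :
    Module.IsTorsion (IwasawaAlgebra 3)
        (Summit.BirchSwinnertonDyer.Rank1Residual.X11b.AcSelmer.XAc (W'.baseChange K) 3 κ 𝔭' ∅ γ) ∧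
      ∃ g' : UnrSeries 3,
        (Summit.BirchSwinnertonDyer.Rank1Residual.X11b.AcSelmer.XAc.charIdeal (W'.baseChange K) 3 κ 𝔭' ∅ γ).map
            (PowerSeries.map (Summit.BirchSwinnertonDyer.Rank1Residual.X11b.Halves.toUnr 3)) = Ideal.span {g'} ∧
          ∃ i : ℕ, ‖((PowerSeries.coeff i g' : unrIntegers 3) : ℂ_[3])‖ = 1 :=
  twinAlgMuZero_conclusion_of_squeeze hK unitCoeffValuesAtTorsionPoints_holds W' N' K Dt' hbucket hsurj hN hK' hH
    hodd κ hκ γ 𝔭 h𝔭 he hf 𝔭' h𝔭' hne ι' hι ΩK Ωp L' hΩK hΩp hL hμ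

/-! ### §8 The transfer by NAME: `C⁺ ∧ (frame with analytic μ = 0) ⟹ TwinAlgMuZeroAtThree` (PROVED) -/

/-- **Frame-with-μ supply (support; W′-level reading of the kernel inputs).** For every datum of
`TwinAlgMuZeroAtThree` there is a BDP frame `(ι′, Ω_K, Ω_p, L′)` of `f_{E′}` at the branch prime `𝔭` whose
`L′ ∈ R₀⟦T⟧` has a unit coefficient (analytic `μ = 0`).  Existence of the frame = the route's frame leaves
(`TwinWanFrameAtThreeGoodSSApZero` for C₀ without its Wan clause; `TwinDegreeFrameAtThreeMultTresT`-side for B);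
the unit coefficient = `TwinMuZeroAtThree` read at the twin (Hsieh 2014 Thm B / Castella 2018 are `p ≥ 5`: same open
status as the kernel's analytic-μ input). -/
def TwinFrameMuSupplyAtThree : Prop :=
  ∀ (W' : WeierstrassCurve ℚ) [W'.IsElliptic] [W'.IsGloballyMinimal] (N' : ℕ) [NeZero N'] (K : Type) [Field K]
    [NumberField K] (Dt' : Literature.NumberTheory.EllipticCurves.ModularForms.ModularParametrizationData W' N'),
    (Literature.NumberTheory.EllipticCurves.Rank1Residual.Mult W' 3 ∧ ¬ 3 ∣ padicValInt 3 W'.minimalDiscriminantInt ∨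
      Literature.NumberTheory.EllipticCurves.Rank1Residual.GoodSS W' 3 ∧ W'.frobeniusTrace 3 = 0) →
    W'.HasSurjectiveModNGaloisRep 3 → W'.conductorNorm ℤ = N' →
    Literature.NumberTheory.EllipticCurves.IsImaginaryQuadratic K →
    Literature.NumberTheory.EllipticCurves.SatisfiesHeegnerHypothesis N' K → Odd (NumberField.discr K) →
    ∀ (κ : Literature.NumberTheory.EllipticCurves.ZpExtension K 3), κ.IsAnticyclotomic →
    ∀ (γ : Field.absoluteGaloisGroup K) [Fact (κ.IsTopGenerator γ)]
      (𝔭 : IsDedekindDomain.HeightOneSpectrum (NumberField.RingOfIntegers K)),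
      ((3 : ℕ) : NumberField.RingOfIntegers K) ∈ 𝔭.asIdeal →
      𝔭.asIdeal.ramificationIdx (NumberField.RingOfIntegers ℚ) = 1 →
      𝔭.asIdeal.inertiaDeg (NumberField.RingOfIntegers ℚ) = 1 →
    ∀ (𝔭' : IsDedekindDomain.HeightOneSpectrum (NumberField.RingOfIntegers K)),
      ((3 : ℕ) : NumberField.RingOfIntegers K) ∈ 𝔭'.asIdeal → 𝔭' ≠ 𝔭 →
    ∃ (ι' : PadicAlgCl 3 ≃+* ℂ),
      Summit.BirchSwinnertonDyer.BirchSwinnertonDyer.Theorems.SchneiderFree.BranchInducesPrime 3 ι' 𝔭 ∧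
      ∃ (ΩK : ℂ) (Ωp : ℂ_[3]) (L' : Literature.NumberTheory.EllipticCurves.UnrSeries 3), ΩK ≠ 0 ∧ Ωp ≠ 0 ∧
        Literature.NumberTheory.EllipticCurves.IsBDPLFunction ι' 𝔭 κ γ Dt'.f ΩK Ωp L' ∧
        ∃ i : ℕ, ‖((PowerSeries.coeff i L' : unrIntegers 3) : ℂ_[3])‖ = 1

/-- **TRANSFER (PROVED, concludes the crux BY NAME): `C⁺ → (frame ∧ analytic μ = 0) → TwinAlgMuZeroAtThree`.** -/
theorem TwinAlgMuZeroAtThree_of_onePointSqueeze (hK : TwistedOnePointKolyvaginAtThree)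
    (hS : TwinFrameMuSupplyAtThree) :
    Summit.BirchSwinnertonDyer.BirchSwinnertonDyer.Theses.UniversalToricDescent.TwinAlgMuZeroAtThree := by
  intro W' _ _ N' _ K _ _ Dt' hbucket hsurj hN hK' hH hodd κ hκ γ _ 𝔭 h𝔭 he hf 𝔭' h𝔭' hne
  obtain ⟨ι', hι, ΩK, Ωp, L', hΩK, hΩp, hL, hμ⟩ :=
    hS W' N' K Dt' hbucket hsurj hN hK' hH hodd κ hκ γ 𝔭 h𝔭 he hf 𝔭' h𝔭' hne
  exact twinAlgMuZero_conclusion_of_C_plus hK W' N' K Dt' hbucket hsurj hN hK' hH hodd κ hκ γ 𝔭 h𝔭 he hf 𝔭' h𝔭'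
    hne ι' hι ΩK Ωp L' hΩK hΩp hL hμ

/-! ### §9 SLACK VARIANT (typing checklist 4c(iv)): an error LINEAR in `φ(3^m)` with coefficient `c < 1` is still free

`μ` is an integer: if `log₃ #(X′/Φ_m X′) ≤ c·φ(3^m) + O(1)` with `c < 1` then `μ(X′) ≤ c < 1`, so `μ(X′) = 0`.  The typed `C⁺`
above asserts the sharp form `c = 0` (what S1–S4 predict: every error is a twisted (co)invariant of a fixed finite module or a
local resolvent term, bounded in `O_χ`-length).  Should a port of S4 (ramified-`χ` `p`-adic Gross–Zagier at `3 ∥ N′` or `a₃ = 0`)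
or the logarithm/divisibility comparison on the formal group over the highly ramified layers `K_{m,w′}` turn out to carry an
error `c·φ(3^m)` with `0 < c < 1`, the line survives with `C⁺_slack` below in place of `C⁺`, at the price of replacing the
Nakayama criterion P2 by the structure-theoretic criterion P2′ (`#(X/Φ_m X) = 3^{μφ(3^m) + λ + O(1)}` for torsion `X` with finite
layers).  `C⁺ ⟹ C⁺_slack` (PROVED, `c = 0`); `P2′ → C⁺_slack → supply → crux` (PROVED modulo the typed P2′). -/

/-- Sub-linear character-layer growth: `#(X/Φ_m X) ≤ 3^{c·φ(3^m) + B}` for `m ≥ m₀`, some `c < 1`. -/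
def SublinearCharLayers (X : Type) [AddCommGroup X] [Module (IwasawaAlgebra 3) X] : Prop :=
  ∃ c : ℝ, c < 1 ∧ ∃ B m₀ : ℕ, ∀ m : ℕ, m₀ ≤ m → Finite (CharLayer X m) ∧
    (Nat.card (CharLayer X m) : ℝ) ≤ (3 : ℝ) ^ (c * (Nat.totient (3 ^ m) : ℝ) + (B : ℝ))

/-- **P2′ (support Prop; PROVED in §11 as `sublinearCharLayersCriterion_holds`, no structure theory needed).** Sub-linear character-layer growth
with coefficient `c < 1` forces `X/3X` finite (i.e. `Λ`-torsion with `μ = 0`): for a f.g. `Λ`-module with one finite layer `X` is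
torsion, and then `log₃ #(X/Φ_m X) = μ(X)·φ(3^m) + λ(X) + O(1)` (`#Λ/(f, Φ_m) = 3^{v₃ N_{ℚ₃(ζ)/ℚ₃} f(ζ−1)}`, pseudo-isomorphism
changes layers by a bounded amount), so `μ ≤ c < 1`.  Washington §13.2–13.3 style; the `c = 0` case is the PROVED P2. -/
def SublinearCharLayersCriterion : Prop :=
  ∀ (X : Type) [AddCommGroup X] [Module (IwasawaAlgebra 3) X] [Module.Finite (IwasawaAlgebra 3) X],
    SublinearCharLayers X → Finite (X ⧸ (augIdealP 3 • (⊤ : Submodule (IwasawaAlgebra 3) X)))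

theorem sublinearCharLayers_of_bounded (X : Type) [AddCommGroup X] [Module (IwasawaAlgebra 3) X]
    (h : BoundedCharLayers X) : SublinearCharLayers X := by
  obtain ⟨B, m₀, h⟩ := h
  refine ⟨0, zero_lt_one, B, m₀, fun m hm ↦ ⟨(h m hm).1, ?_⟩⟩
  have h2 := (h m hm).2
  rw [zero_mul, zero_add, Real.rpow_natCast]
  exact_mod_cast h2

/-- **K1_slack = C⁺_slack**: as `TwistedOnePointKolyvaginAtThree`, with the bound `3^{c·φ(3^m) + B}` for some `c < 1`. -/
def TwistedOnePointKolyvaginAtThreeSlack : Prop :=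
  ∀ (W' : WeierstrassCurve ℚ) [W'.IsElliptic] [W'.IsGloballyMinimal] (N' : ℕ) [NeZero N'] (K : Type) [Field K]
    [NumberField K] (Dt' : Literature.NumberTheory.EllipticCurves.ModularForms.ModularParametrizationData W' N'),
    (Literature.NumberTheory.EllipticCurves.Rank1Residual.Mult W' 3 ∧ ¬ 3 ∣ padicValInt 3 W'.minimalDiscriminantInt ∨
      Literature.NumberTheory.EllipticCurves.Rank1Residual.GoodSS W' 3 ∧ W'.frobeniusTrace 3 = 0) →
    W'.HasSurjectiveModNGaloisRep 3 → W'.conductorNorm ℤ = N' →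
    Literature.NumberTheory.EllipticCurves.IsImaginaryQuadratic K →
    Literature.NumberTheory.EllipticCurves.SatisfiesHeegnerHypothesis N' K → Odd (NumberField.discr K) →
    ∀ (κ : Literature.NumberTheory.EllipticCurves.ZpExtension K 3), κ.IsAnticyclotomic →
    ∀ (γ : Field.absoluteGaloisGroup K) [Fact (κ.IsTopGenerator γ)]
      (𝔭 : IsDedekindDomain.HeightOneSpectrum (NumberField.RingOfIntegers K)),
      ((3 : ℕ) : NumberField.RingOfIntegers K) ∈ 𝔭.asIdeal →
      𝔭.asIdeal.ramificationIdx (NumberField.RingOfIntegers ℚ) = 1 →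
      𝔭.asIdeal.inertiaDeg (NumberField.RingOfIntegers ℚ) = 1 →
    ∀ (𝔭' : IsDedekindDomain.HeightOneSpectrum (NumberField.RingOfIntegers K)),
      ((3 : ℕ) : NumberField.RingOfIntegers K) ∈ 𝔭'.asIdeal → 𝔭' ≠ 𝔭 →
    ∀ (ι' : PadicAlgCl 3 ≃+* ℂ),
      Summit.BirchSwinnertonDyer.BirchSwinnertonDyer.Theorems.SchneiderFree.BranchInducesPrime 3 ι' 𝔭 →
    ∀ (ΩK : ℂ) (Ωp : ℂ_[3]) (L' : Literature.NumberTheory.EllipticCurves.UnrSeries 3), ΩK ≠ 0 → Ωp ≠ 0 →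
      Literature.NumberTheory.EllipticCurves.IsBDPLFunction ι' 𝔭 κ γ Dt'.f ΩK Ωp L' →
    ∃ c : ℝ, c < 1 ∧ ∃ B m₀ : ℕ, ∀ m : ℕ, m₀ ≤ m → ∀ ζ : ℂ_[3], IsPrimitiveRoot ζ (3 ^ m) → ∀ v : ℂ_[3],
      L'.HasValueAt (ζ - 1) v → v ≠ 0 →
      Finite (CharLayer (Summit.BirchSwinnertonDyer.Rank1Residual.X11b.AcSelmer.XAc (W'.baseChange K) 3 κ 𝔭' ∅ γ) m) ∧
        (Nat.card (CharLayer (Summit.BirchSwinnertonDyer.Rank1Residual.X11b.AcSelmer.XAc (W'.baseChange K) 3 κ 𝔭' ∅ γ) m) : ℝ)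
          * ‖v‖ ^ Nat.totient (3 ^ m) ≤ (3 : ℝ) ^ (c * (Nat.totient (3 ^ m) : ℝ) + (B : ℝ))

/-- `C⁺ ⟹ C⁺_slack` (`c = 0`; PROVED). -/
theorem slack_of_C_plus (hK : TwistedOnePointKolyvaginAtThree) : TwistedOnePointKolyvaginAtThreeSlack := by
  intro W' _ _ N' _ K _ _ Dt' hb hs hN hK' hH ho κ hκ γ _ 𝔭 h1 h2 h3 𝔭' h4 h5 ι' hι ΩK Ωp L' hΩK hΩp hL
  obtain ⟨B, m₀, h⟩ := hK W' N' K Dt' hb hs hN hK' hH ho κ hκ γ 𝔭 h1 h2 h3 𝔭' h4 h5 ι' hι ΩK Ωp L' hΩK hΩp hL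
  refine ⟨0, zero_lt_one, B, m₀, fun m hm ζ hζ v hv hv0 ↦ ?_⟩
  obtain ⟨hf, hi⟩ := h m hm ζ hζ v hv hv0
  refine ⟨hf, ?_⟩
  rw [zero_mul, zero_add, Real.rpow_natCast]
  exact hi

/-- Exponent bookkeeping with slack (PROVED). -/
theorem card_le_of_onePoint_slack {c : ℝ} {card B lam φ : ℕ} {nv nz : ℝ}
    (hineq : (card : ℝ) * nv ^ φ ≤ (3 : ℝ) ^ (c * (φ : ℝ) + (B : ℝ))) (hv : nv = nz ^ lam)
    (hz : nz ^ φ = (3 : ℝ)⁻¹) :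
    (card : ℝ) ≤ (3 : ℝ) ^ (c * (φ : ℝ) + ((B + lam : ℕ) : ℝ)) := by
  have hpow : nv ^ φ = ((3 : ℝ) ^ lam)⁻¹ := by
    rw [hv, ← pow_mul, mul_comm, pow_mul, hz, inv_pow]
  rw [hpow] at hineq
  have hlam : (0 : ℝ) < (3 : ℝ) ^ lam := pow_pos (by norm_num) lam
  have h1 : (card : ℝ) ≤ (3 : ℝ) ^ (c * (φ : ℝ) + (B : ℝ)) * (3 : ℝ) ^ lam := by
    have := mul_le_mul_of_nonneg_right hineq hlam.le
    rwa [mul_assoc, inv_mul_cancel₀ hlam.ne', mul_one] at this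
  calc (card : ℝ) ≤ (3 : ℝ) ^ (c * (φ : ℝ) + (B : ℝ)) * (3 : ℝ) ^ lam := h1
    _ = (3 : ℝ) ^ (c * (φ : ℝ) + ((B + lam : ℕ) : ℝ)) := by
        rw [← Real.rpow_natCast (3 : ℝ) lam, ← Real.rpow_add (by norm_num : (0 : ℝ) < 3)]
        congr 1
        push_cast
        ring

/-- **THE SQUEEZE WITH SLACK (PROVED): `C⁺_slack` + P1 + P0 ⟹ sub-linear character layers of `X′`.** -/
theorem sublinearCharLayers_of_squeezeSlack (hK : TwistedOnePointKolyvaginAtThreeSlack)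
    (hP1 : UnitCoeffValuesAtTorsionPoints) (hP0 : PrimitiveRootNormAtThree)
    (hroots : ∀ m : ℕ, 1 ≤ m → ∃ ζ : ℂ_[3], IsPrimitiveRoot ζ (3 ^ m))
    (hval : ∀ (L : UnrSeries 3) (m : ℕ), 1 ≤ m → ∀ ζ : ℂ_[3], IsPrimitiveRoot ζ (3 ^ m) → ∃ v, L.HasValueAt (ζ - 1) v)
    (W' : WeierstrassCurve ℚ) [W'.IsElliptic] [W'.IsGloballyMinimal] (N' : ℕ) [NeZero N'] (K : Type) [Field K]
    [NumberField K] (Dt' : Literature.NumberTheory.EllipticCurves.ModularForms.ModularParametrizationData W' N')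
    (hbucket : Literature.NumberTheory.EllipticCurves.Rank1Residual.Mult W' 3 ∧
        ¬ 3 ∣ padicValInt 3 W'.minimalDiscriminantInt ∨
      Literature.NumberTheory.EllipticCurves.Rank1Residual.GoodSS W' 3 ∧ W'.frobeniusTrace 3 = 0)
    (hsurj : W'.HasSurjectiveModNGaloisRep 3) (hN : W'.conductorNorm ℤ = N')
    (hK' : Literature.NumberTheory.EllipticCurves.IsImaginaryQuadratic K)
    (hH : Literature.NumberTheory.EllipticCurves.SatisfiesHeegnerHypothesis N' K) (hodd : Odd (NumberField.discr K))
    (κ : Literature.NumberTheory.EllipticCurves.ZpExtension K 3) (hκ : κ.IsAnticyclotomic)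
    (γ : Field.absoluteGaloisGroup K) [Fact (κ.IsTopGenerator γ)]
    (𝔭 : IsDedekindDomain.HeightOneSpectrum (NumberField.RingOfIntegers K))
    (h𝔭 : ((3 : ℕ) : NumberField.RingOfIntegers K) ∈ 𝔭.asIdeal)
    (he : 𝔭.asIdeal.ramificationIdx (NumberField.RingOfIntegers ℚ) = 1)
    (hf : 𝔭.asIdeal.inertiaDeg (NumberField.RingOfIntegers ℚ) = 1)
    (𝔭' : IsDedekindDomain.HeightOneSpectrum (NumberField.RingOfIntegers K))
    (h𝔭' : ((3 : ℕ) : NumberField.RingOfIntegers K) ∈ 𝔭'.asIdeal) (hne : 𝔭' ≠ 𝔭)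
    (ι' : PadicAlgCl 3 ≃+* ℂ)
    (hι : Summit.BirchSwinnertonDyer.BirchSwinnertonDyer.Theorems.SchneiderFree.BranchInducesPrime 3 ι' 𝔭)
    (ΩK : ℂ) (Ωp : ℂ_[3]) (L' : Literature.NumberTheory.EllipticCurves.UnrSeries 3) (hΩK : ΩK ≠ 0) (hΩp : Ωp ≠ 0)
    (hL : Literature.NumberTheory.EllipticCurves.IsBDPLFunction ι' 𝔭 κ γ Dt'.f ΩK Ωp L')
    (hμ : ∃ i : ℕ, ‖((PowerSeries.coeff i L' : unrIntegers 3) : ℂ_[3])‖ = 1) :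
    SublinearCharLayers (Summit.BirchSwinnertonDyer.Rank1Residual.X11b.AcSelmer.XAc (W'.baseChange K) 3 κ 𝔭' ∅ γ) := by
  obtain ⟨c, hc, B, m₀, hB⟩ := hK W' N' K Dt' hbucket hsurj hN hK' hH hodd κ hκ γ 𝔭 h𝔭 he hf 𝔭' h𝔭' hne ι' hι ΩK
    Ωp L' hΩK hΩp hL
  obtain ⟨lam, m₁, hlam⟩ := hP1 L' hμ
  refine ⟨c, hc, B + lam, max (max m₀ m₁) 1, fun m hm ↦ ?_⟩
  have hm₀ : m₀ ≤ m := le_trans (le_trans (le_max_left _ _) (le_max_left _ _)) hm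
  have hm₁ : m₁ ≤ m := le_trans (le_trans (le_max_right _ _) (le_max_left _ _)) hm
  have hm1 : 1 ≤ m := le_trans (le_max_right _ _) hm
  obtain ⟨ζ, hζ⟩ := hroots m hm1
  obtain ⟨v, hv⟩ := hval L' m hm1 ζ hζ
  have hvne : v ≠ 0 := by
    intro h0
    have hn := hlam m hm₁ ζ hζ v hv
    rw [h0, norm_zero] at hn
    have hz : ‖ζ - 1‖ ≠ 0 := by
      intro hz
      have h3 := hP0 m hm1 ζ hζ
      rw [hz, zero_pow (Nat.totient_pos.2 (pow_pos (by norm_num) m)).ne'] at h3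
      norm_num at h3
    exact (pow_ne_zero lam hz) hn.symm
  obtain ⟨hfin, hineq⟩ := hB m hm₀ ζ hζ v hv hvne
  exact ⟨hfin, card_le_of_onePoint_slack hineq (hlam m hm₁ ζ hζ v hv) (hP0 m hm1 ζ hζ)⟩

/-- Endgame from sub-linear layers (PROVED modulo the typed P2′). -/
theorem conclusion_of_sublinearCharLayers (hcrit : SublinearCharLayersCriterion)
    {K : Type} [Field K] [NumberField K] (W : WeierstrassCurve K) [W.IsElliptic]
    (κ : ZpExtension K 3) (𝔭 : HeightOneSpectrum (𝓞 K)) (γ : absoluteGaloisGroup K)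
    [Fact (κ.IsTopGenerator γ)] (hX : SublinearCharLayers (XAc W 3 κ 𝔭 ∅ γ)) :
    Module.IsTorsion (IwasawaAlgebra 3) (XAc W 3 κ 𝔭 ∅ γ) ∧
      ∃ g : UnrSeries 3,
        (XAc.charIdeal W 3 κ 𝔭 ∅ γ).map (PowerSeries.map (Halves.toUnr 3)) = Ideal.span {g} ∧
          ∃ i : ℕ, ‖((PowerSeries.coeff i g : unrIntegers 3) : ℂ_[3])‖ = 1 := by
  haveI := XAc.module_finite κ 𝔭 ∅ γ Set.finite_empty (W := W)
  have hfin := hcrit (XAc W 3 κ 𝔭 ∅ γ) hX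
  have hfg := moduleFinite_padicInt_of_finite_quotient_augIdealP 3 (XAc W 3 κ 𝔭 ∅ γ) hfin
  exact isTorsion_and_exists_generator_of_finite_pTorsion W 3 κ 𝔭 ∅ γ Set.finite_empty
    (finite_pTorsion_of_moduleFinite_padicInt W 3 κ 𝔭 ∅ γ hfg)

/-- **TRANSFER WITH SLACK (PROVED modulo P2′): `P2′ → C⁺_slack → (frame ∧ analytic μ = 0) → TwinAlgMuZeroAtThree`.** -/
theorem TwinAlgMuZeroAtThree_of_onePointSqueezeSlack (hcrit : SublinearCharLayersCriterion)
    (hK : TwistedOnePointKolyvaginAtThreeSlack) (hS : TwinFrameMuSupplyAtThree) :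
    Summit.BirchSwinnertonDyer.BirchSwinnertonDyer.Theses.UniversalToricDescent.TwinAlgMuZeroAtThree := by
  intro W' _ _ N' _ K _ _ Dt' hbucket hsurj hN hK' hH hodd κ hκ γ _ 𝔭 h𝔭 he hf 𝔭' h𝔭' hne
  obtain ⟨ι', hι, ΩK, Ωp, L', hΩK, hΩp, hL, hμ⟩ :=
    hS W' N' K Dt' hbucket hsurj hN hK' hH hodd κ hκ γ 𝔭 h𝔭 he hf 𝔭' h𝔭' hne
  have hroots : ∀ m : ℕ, 1 ≤ m → ∃ ζ : ℂ_[3], IsPrimitiveRoot ζ (3 ^ m) :=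
    fun m _ ↦ exists_isPrimitiveRoot_padicComplex m
  have hval : ∀ (L : UnrSeries 3) (m : ℕ), 1 ≤ m → ∀ ζ : ℂ_[3], IsPrimitiveRoot ζ (3 ^ m) →
      ∃ v, L.HasValueAt (ζ - 1) v := by
    intro L m hm ζ hζ
    refine exists_hasValueAt L ?_
    have hφ := primitiveRootNormAtThree_holds m hm ζ hζ
    by_contra hge
    push_neg at hge
    have : (1 : ℝ) ≤ ‖ζ - 1‖ ^ Nat.totient (3 ^ m) := one_le_pow₀ hge
    rw [hφ] at this
    norm_num at this
  exact conclusion_of_sublinearCharLayers hcrit (W'.baseChange K) κ 𝔭' γ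
    (sublinearCharLayers_of_squeezeSlack hK unitCoeffValuesAtTorsionPoints_holds primitiveRootNormAtThree_holds hroots
      hval W' N' K Dt' hbucket hsurj hN hK' hH hodd κ hκ γ 𝔭 h𝔭 he hf 𝔭' h𝔭' hne ι' hι ΩK Ωp L' hΩK hΩp hL hμ)


/-! ### §10 SPARSE-LEVEL VARIANT (PROVED): the squeeze along ANY unbounded set of levels `m` suffices

At `a₃ = 0` the printed ramified-character interpolation formula for the BDP `L`-function — Castella–Wan, arXiv:1506.02538
p. 10 (following Castella–Hsieh): `φ(ℒ_𝔭(f)) = 𝔤(χ_φ⁻¹)·χ_φ(p^n)·p^{-n}·Σ_{σ ∈ Gal(H_{p^n}/K)} χ(σ) log_{ω_f}(z_{p^n}^σ)` for a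
primitive character `φ` of `Γ⁻/p^mΓ⁻` with `n := m − t − a` EVEN — and the signed big logarithm `LOG⁺` (loc. cit. p. 6) live on ONE
parity class of conductor exponents.  The Nakayama criterion needs the layer bound only along an UNBOUNDED set of levels: the
`(Tⁿ,3)`-layers are monotone in `n` and each is a quotient of any character layer of level `m ≥ n + 1`.  So `C⁺` may be weakened
to hold for infinitely many `m` (`C⁺_sparse`), e.g. one parity class — at `a₃ = 0` one signed logarithm then suffices (S4 port). -/

/-- Character layers of bounded order along an unbounded set of levels. -/
def FrequentlyBoundedCharLayers (X : Type) [AddCommGroup X] [Module (IwasawaAlgebra 3) X] : Prop :=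
  ∃ B : ℕ, ∀ m₁ : ℕ, ∃ m : ℕ, m₁ ≤ m ∧ Finite (CharLayer X m) ∧ Nat.card (CharLayer X m) ≤ 3 ^ B

theorem frequently_of_boundedCharLayers (X : Type) [AddCommGroup X] [Module (IwasawaAlgebra 3) X]
    (h : BoundedCharLayers X) : FrequentlyBoundedCharLayers X := by
  obtain ⟨B, m₀, hB⟩ := h
  exact ⟨B, fun m₁ ↦ ⟨max m₀ m₁, le_max_right _ _, hB _ (le_max_left _ _)⟩⟩

/-- The Nakayama endgame from a bound on all `(Tⁿ,3)`-layers (the body of P2's proof, verbatim). -/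
theorem finite_augQuot_of_tnLayerBound (X : Type) [AddCommGroup X] [Module (IwasawaAlgebra 3) X]
    [Module.Finite (IwasawaAlgebra 3) X] {B : ℕ}
    (hQ : ∀ n : ℕ, Finite (X ⧸ (layerIdeal n • (⊤ : Submodule (IwasawaAlgebra 3) X))) ∧
      Nat.card (X ⧸ (layerIdeal n • (⊤ : Submodule (IwasawaAlgebra 3) X))) ≤ 3 ^ B) :
    Finite (X ⧸ (augIdealP 3 • (⊤ : Submodule (IwasawaAlgebra 3) X))) := by
  -- the orders stabilise: `(T^n,3)X = (T^{n+1},3)X` for some `n`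
  obtain ⟨n, hn⟩ := exists_succ_le_of_bounded
    (fun n => Nat.card (X ⧸ (layerIdeal n • (⊤ : Submodule (IwasawaAlgebra 3) X)))) (3 ^ B) (fun n => (hQ n).2)
  have hle : layerIdeal (n + 1) • (⊤ : Submodule (IwasawaAlgebra 3) X) ≤ layerIdeal n • ⊤ :=
    Submodule.smul_mono_left (layerIdeal_anti (Nat.le_succ n))
  haveI := (hQ (n + 1)).1
  have hge : layerIdeal n • (⊤ : Submodule (IwasawaAlgebra 3) X) ≤ layerIdeal (n + 1) • ⊤ :=
    le_of_card_quot_le hle hn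
  -- Nakayama in `Y = X/3X` for `N = T^n Y`
  set P3 : Submodule (IwasawaAlgebra 3) X := Ideal.span {(3 : IwasawaAlgebra 3)} • ⊤ with hP3
  set N : Submodule (IwasawaAlgebra 3) (X ⧸ P3) :=
    Ideal.span {(PowerSeries.X ^ n : IwasawaAlgebra 3)} • ⊤ with hN
  have hXn : ∀ x : X, ∃ w w' : X, (PowerSeries.X ^ n : IwasawaAlgebra 3) • x =
      (PowerSeries.X ^ (n + 1) : IwasawaAlgebra 3) • w + (3 : IwasawaAlgebra 3) • w' := by
    intro x
    have hx : (PowerSeries.X ^ n : IwasawaAlgebra 3) • x ∈ layerIdeal (n + 1) • (⊤ : Submodule _ X) :=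
      hge (Submodule.smul_mem_smul (X_pow_mem_layerIdeal n) Submodule.mem_top)
    exact mem_span_pair_smul_top hx
  have hNle : N ≤ Ideal.span {(PowerSeries.X : IwasawaAlgebra 3)} • N := by
    rw [hN, Submodule.smul_le]
    intro r hr y _
    obtain ⟨a, rfl⟩ := Ideal.mem_span_singleton'.1 hr
    rw [mul_smul]
    refine Submodule.smul_mem _ a ?_
    induction y using Submodule.Quotient.induction_on with
    | H x =>
      obtain ⟨w, w', hw⟩ := hXn x
      rw [← Submodule.Quotient.mk_smul, hw, Submodule.Quotient.mk_add, Submodule.Quotient.mk_smul,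
        Submodule.Quotient.mk_smul]
      have h3w : (Submodule.Quotient.mk ((3 : IwasawaAlgebra 3) • w') : X ⧸ P3) = 0 := by
        rw [Submodule.Quotient.mk_eq_zero, hP3]
        exact Submodule.smul_mem_smul (Ideal.subset_span rfl) Submodule.mem_top
      rw [Submodule.Quotient.mk_smul] at h3w
      rw [h3w, add_zero, pow_succ, mul_comm, mul_smul]
      exact Submodule.smul_mem_smul (Ideal.subset_span rfl)
        (Submodule.smul_mem_smul (Ideal.subset_span rfl) Submodule.mem_top)
  have hNfg : N.FG := by
    haveI : IsNoetherian (IwasawaAlgebra 3) (X ⧸ P3) := isNoetherian_of_isNoetherianRing_of_finite _ _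
    exact IsNoetherian.noetherian N
  have hN0 : N = ⊥ := Submodule.eq_bot_of_le_smul_of_le_jacobson_bot _ N hNfg hNle span_X_le_jacobson_bot
  -- hence `T^n X ⊆ 3X`, so `(T^n,3)X = 3X` and `X/3X` is the finite layer
  have hXn3 : ∀ x : X, (PowerSeries.X ^ n : IwasawaAlgebra 3) • x ∈ P3 := by
    intro x
    have : (Submodule.Quotient.mk ((PowerSeries.X ^ n : IwasawaAlgebra 3) • x) : X ⧸ P3) ∈ N := by
      rw [Submodule.Quotient.mk_smul, hN]
      exact Submodule.smul_mem_smul (Ideal.subset_span rfl) Submodule.mem_top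
    rw [hN0, Submodule.mem_bot] at this
    exact (Submodule.Quotient.mk_eq_zero P3).1 this
  have hEq : layerIdeal n • (⊤ : Submodule (IwasawaAlgebra 3) X) = P3 := by
    apply le_antisymm
    · rw [Submodule.smul_le]
      intro r hr x _
      obtain ⟨a, b, rfl⟩ := Ideal.mem_span_pair.1 hr
      rw [add_smul, mul_smul, mul_smul]
      exact P3.add_mem (P3.smul_mem a (hXn3 x))
        (P3.smul_mem b (Submodule.smul_mem_smul (Ideal.subset_span rfl) Submodule.mem_top))
    · exact Submodule.smul_mono_left
        ((Ideal.span_singleton_le_iff_mem _).2 (three_mem_layerIdeal n))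
  have hC : (PowerSeries.C ((3 : ℕ) : ℤ_[3]) : IwasawaAlgebra 3) = 3 := by
    rw [map_natCast, Nat.cast_ofNat]
  change Finite (X ⧸ (Ideal.span {PowerSeries.C ((3 : ℕ) : ℤ_[3])} • (⊤ : Submodule (IwasawaAlgebra 3) X)))
  rw [hC, ← hP3, ← hEq]
  exact (hQ n).1

/-- **P2-sparse (PROVED).** Bounded character layers along an unbounded set of levels force `X/3X` finite. -/
theorem finite_augQuot_of_frequentlyBoundedCharLayers (X : Type) [AddCommGroup X] [Module (IwasawaAlgebra 3) X]
    [Module.Finite (IwasawaAlgebra 3) X] (hX : FrequentlyBoundedCharLayers X) :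
    Finite (X ⧸ (augIdealP 3 • (⊤ : Submodule (IwasawaAlgebra 3) X))) := by
  obtain ⟨B, hB⟩ := hX
  refine finite_augQuot_of_tnLayerBound X (B := B) fun n ↦ ?_
  obtain ⟨m, hm, hfin, hcard⟩ := hB (n + 1)
  have hm1 : 1 ≤ m := le_trans (by omega) hm
  have hnN : n ≤ 2 * 3 ^ (m - 1) := by
    have h1 : m - 1 < 3 ^ (m - 1) := Nat.lt_pow_self (by norm_num)
    omega
  have hle : Ideal.span {cycLayer m} ≤ layerIdeal n := (span_cycLayer_le _ hm1).trans (layerIdeal_anti hnN)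
  obtain ⟨hf, hc⟩ := finite_quot_of_le (X := X) hle hfin
  exact ⟨hf, hc.trans hcard⟩

/-- **Endgame along sparse levels (PROVED).** -/
theorem conclusion_of_frequentlyBoundedCharLayers {K : Type} [Field K] [NumberField K] (W : WeierstrassCurve K)
    [W.IsElliptic] (κ : ZpExtension K 3) (𝔭 : HeightOneSpectrum (𝓞 K)) (γ : absoluteGaloisGroup K)
    [Fact (κ.IsTopGenerator γ)] (hX : FrequentlyBoundedCharLayers (XAc W 3 κ 𝔭 ∅ γ)) :
    Module.IsTorsion (IwasawaAlgebra 3) (XAc W 3 κ 𝔭 ∅ γ) ∧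
      ∃ g : UnrSeries 3,
        (XAc.charIdeal W 3 κ 𝔭 ∅ γ).map (PowerSeries.map (Halves.toUnr 3)) = Ideal.span {g} ∧
          ∃ i : ℕ, ‖((PowerSeries.coeff i g : unrIntegers 3) : ℂ_[3])‖ = 1 := by
  haveI := XAc.module_finite κ 𝔭 ∅ γ Set.finite_empty (W := W)
  have hfin := finite_augQuot_of_frequentlyBoundedCharLayers (XAc W 3 κ 𝔭 ∅ γ) hX
  have hfg := moduleFinite_padicInt_of_finite_quotient_augIdealP 3 (XAc W 3 κ 𝔭 ∅ γ) hfin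
  exact isTorsion_and_exists_generator_of_finite_pTorsion W 3 κ 𝔭 ∅ γ Set.finite_empty
    (finite_pTorsion_of_moduleFinite_padicInt W 3 κ 𝔭 ∅ γ hfg)

/-- **`C⁺_sparse`**: the one-point squeeze asserted only along an unbounded set of levels `m` (same binders and bound as `C⁺`). -/
def TwistedOnePointKolyvaginAtThreeSparse : Prop :=
  ∀ (W' : WeierstrassCurve ℚ) [W'.IsElliptic] [W'.IsGloballyMinimal] (N' : ℕ) [NeZero N'] (K : Type) [Field K]
    [NumberField K] (Dt' : Literature.NumberTheory.EllipticCurves.ModularForms.ModularParametrizationData W' N'),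
    (Literature.NumberTheory.EllipticCurves.Rank1Residual.Mult W' 3 ∧ ¬ 3 ∣ padicValInt 3 W'.minimalDiscriminantInt ∨
      Literature.NumberTheory.EllipticCurves.Rank1Residual.GoodSS W' 3 ∧ W'.frobeniusTrace 3 = 0) →
    W'.HasSurjectiveModNGaloisRep 3 → W'.conductorNorm ℤ = N' →
    Literature.NumberTheory.EllipticCurves.IsImaginaryQuadratic K →
    Literature.NumberTheory.EllipticCurves.SatisfiesHeegnerHypothesis N' K → Odd (NumberField.discr K) →
    ∀ (κ : Literature.NumberTheory.EllipticCurves.ZpExtension K 3), κ.IsAnticyclotomic →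
    ∀ (γ : Field.absoluteGaloisGroup K) [Fact (κ.IsTopGenerator γ)]
      (𝔭 : IsDedekindDomain.HeightOneSpectrum (NumberField.RingOfIntegers K)),
      ((3 : ℕ) : NumberField.RingOfIntegers K) ∈ 𝔭.asIdeal →
      𝔭.asIdeal.ramificationIdx (NumberField.RingOfIntegers ℚ) = 1 →
      𝔭.asIdeal.inertiaDeg (NumberField.RingOfIntegers ℚ) = 1 →
    ∀ (𝔭' : IsDedekindDomain.HeightOneSpectrum (NumberField.RingOfIntegers K)),
      ((3 : ℕ) : NumberField.RingOfIntegers K) ∈ 𝔭'.asIdeal → 𝔭' ≠ 𝔭 →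
    ∀ (ι' : PadicAlgCl 3 ≃+* ℂ),
      Summit.BirchSwinnertonDyer.BirchSwinnertonDyer.Theorems.SchneiderFree.BranchInducesPrime 3 ι' 𝔭 →
    ∀ (ΩK : ℂ) (Ωp : ℂ_[3]) (L' : Literature.NumberTheory.EllipticCurves.UnrSeries 3), ΩK ≠ 0 → Ωp ≠ 0 →
      Literature.NumberTheory.EllipticCurves.IsBDPLFunction ι' 𝔭 κ γ Dt'.f ΩK Ωp L' →
    ∃ B : ℕ, ∀ m₁ : ℕ, ∃ m : ℕ, m₁ ≤ m ∧ ∀ ζ : ℂ_[3], IsPrimitiveRoot ζ (3 ^ m) → ∀ v : ℂ_[3], L'.HasValueAt (ζ - 1) v →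
      v ≠ 0 →
      Finite (CharLayer (Summit.BirchSwinnertonDyer.Rank1Residual.X11b.AcSelmer.XAc (W'.baseChange K) 3 κ 𝔭' ∅ γ) m) ∧
        (Nat.card (CharLayer (Summit.BirchSwinnertonDyer.Rank1Residual.X11b.AcSelmer.XAc (W'.baseChange K) 3 κ 𝔭' ∅ γ) m) : ℝ)
          * ‖v‖ ^ Nat.totient (3 ^ m) ≤ (3 : ℝ) ^ B

/-! ### §4 The squeeze: exponent bookkeeping (PROVED) -/


/-- `C⁺ ⟹ C⁺_sparse` (PROVED). -/
theorem sparse_of_C_plus (hK : TwistedOnePointKolyvaginAtThree) : TwistedOnePointKolyvaginAtThreeSparse := by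
  intro W' _ _ N' _ K _ _ Dt' hb hs hN hK' hH ho κ hκ γ _ 𝔭 h1 h2 h3 𝔭' h4 h5 ι' hι ΩK Ωp L' hΩK hΩp hL
  obtain ⟨B, m₀, h⟩ := hK W' N' K Dt' hb hs hN hK' hH ho κ hκ γ 𝔭 h1 h2 h3 𝔭' h4 h5 ι' hι ΩK Ωp L' hΩK hΩp hL
  exact ⟨B, fun m₁ ↦ ⟨max m₀ m₁, le_max_right _ _, h _ (le_max_left _ _)⟩⟩

/-- **The squeeze along sparse levels (PROVED).** -/
theorem frequentlyBoundedCharLayers_of_squeezeSparse (hK : TwistedOnePointKolyvaginAtThreeSparse) (hP1 : UnitCoeffValuesAtTorsionPoints)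
    (hP0 : PrimitiveRootNormAtThree)
    (hroots : ∀ m : ℕ, 1 ≤ m → ∃ ζ : ℂ_[3], IsPrimitiveRoot ζ (3 ^ m))
    (hval : ∀ (L : UnrSeries 3) (m : ℕ), 1 ≤ m → ∀ ζ : ℂ_[3], IsPrimitiveRoot ζ (3 ^ m) → ∃ v, L.HasValueAt (ζ - 1) v)
    (W' : WeierstrassCurve ℚ) [W'.IsElliptic] [W'.IsGloballyMinimal] (N' : ℕ) [NeZero N'] (K : Type) [Field K]
    [NumberField K] (Dt' : Literature.NumberTheory.EllipticCurves.ModularForms.ModularParametrizationData W' N')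
    (hbucket : Literature.NumberTheory.EllipticCurves.Rank1Residual.Mult W' 3 ∧
        ¬ 3 ∣ padicValInt 3 W'.minimalDiscriminantInt ∨
      Literature.NumberTheory.EllipticCurves.Rank1Residual.GoodSS W' 3 ∧ W'.frobeniusTrace 3 = 0)
    (hsurj : W'.HasSurjectiveModNGaloisRep 3) (hN : W'.conductorNorm ℤ = N')
    (hK' : Literature.NumberTheory.EllipticCurves.IsImaginaryQuadratic K)
    (hH : Literature.NumberTheory.EllipticCurves.SatisfiesHeegnerHypothesis N' K) (hodd : Odd (NumberField.discr K))
    (κ : Literature.NumberTheory.EllipticCurves.ZpExtension K 3) (hκ : κ.IsAnticyclotomic)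
    (γ : Field.absoluteGaloisGroup K) [Fact (κ.IsTopGenerator γ)]
    (𝔭 : IsDedekindDomain.HeightOneSpectrum (NumberField.RingOfIntegers K))
    (h𝔭 : ((3 : ℕ) : NumberField.RingOfIntegers K) ∈ 𝔭.asIdeal)
    (he : 𝔭.asIdeal.ramificationIdx (NumberField.RingOfIntegers ℚ) = 1)
    (hf : 𝔭.asIdeal.inertiaDeg (NumberField.RingOfIntegers ℚ) = 1)
    (𝔭' : IsDedekindDomain.HeightOneSpectrum (NumberField.RingOfIntegers K))
    (h𝔭' : ((3 : ℕ) : NumberField.RingOfIntegers K) ∈ 𝔭'.asIdeal) (hne : 𝔭' ≠ 𝔭)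
    (ι' : PadicAlgCl 3 ≃+* ℂ)
    (hι : Summit.BirchSwinnertonDyer.BirchSwinnertonDyer.Theorems.SchneiderFree.BranchInducesPrime 3 ι' 𝔭)
    (ΩK : ℂ) (Ωp : ℂ_[3]) (L' : Literature.NumberTheory.EllipticCurves.UnrSeries 3) (hΩK : ΩK ≠ 0) (hΩp : Ωp ≠ 0)
    (hL : Literature.NumberTheory.EllipticCurves.IsBDPLFunction ι' 𝔭 κ γ Dt'.f ΩK Ωp L')
    (hμ : ∃ i : ℕ, ‖((PowerSeries.coeff i L' : unrIntegers 3) : ℂ_[3])‖ = 1) :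
    FrequentlyBoundedCharLayers
      (Summit.BirchSwinnertonDyer.Rank1Residual.X11b.AcSelmer.XAc (W'.baseChange K) 3 κ 𝔭' ∅ γ) := by
  obtain ⟨B, hB⟩ := hK W' N' K Dt' hbucket hsurj hN hK' hH hodd κ hκ γ 𝔭 h𝔭 he hf 𝔭' h𝔭' hne ι' hι ΩK Ωp L'
    hΩK hΩp hL
  obtain ⟨lam, m₁, hlam⟩ := hP1 L' hμ
  refine ⟨B + lam, fun m₂ ↦ ?_⟩
  obtain ⟨m, hm, hBm⟩ := hB (max (max m₂ m₁) 1)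
  have hm₂ : m₂ ≤ m := le_trans (le_trans (le_max_left _ _) (le_max_left _ _)) hm
  have hm₁ : m₁ ≤ m := le_trans (le_trans (le_max_right _ _) (le_max_left _ _)) hm
  have hm1 : 1 ≤ m := le_trans (le_max_right _ _) hm
  obtain ⟨ζ, hζ⟩ := hroots m hm1
  obtain ⟨v, hv⟩ := hval L' m hm1 ζ hζ
  have hvne : v ≠ 0 := by
    intro h0
    have hn := hlam m hm₁ ζ hζ v hv
    rw [h0, norm_zero] at hn
    have hz : ‖ζ - 1‖ ≠ 0 := by
      intro hz
      have h3 := hP0 m hm1 ζ hζ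
      rw [hz, zero_pow (Nat.totient_pos.2 (pow_pos (by norm_num) m)).ne'] at h3
      norm_num at h3
    exact (pow_ne_zero lam hz) hn.symm
  obtain ⟨hfin, hineq⟩ := hBm ζ hζ v hv hvne
  exact ⟨m, hm₂, hfin, card_le_of_onePoint hineq (hlam m hm₁ ζ hζ v hv) (hP0 m hm1 ζ hζ)⟩

/-- **Conclusion of the crux for one datum from `C⁺_sparse` (PROVED).** -/
theorem twinAlgMuZero_conclusion_of_squeezeSparse (hK : TwistedOnePointKolyvaginAtThreeSparse)
    (hP1 : UnitCoeffValuesAtTorsionPoints)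
    (W' : WeierstrassCurve ℚ) [W'.IsElliptic] [W'.IsGloballyMinimal] (N' : ℕ) [NeZero N'] (K : Type) [Field K]
    [NumberField K] (Dt' : Literature.NumberTheory.EllipticCurves.ModularForms.ModularParametrizationData W' N')
    (hbucket : Literature.NumberTheory.EllipticCurves.Rank1Residual.Mult W' 3 ∧
        ¬ 3 ∣ padicValInt 3 W'.minimalDiscriminantInt ∨
      Literature.NumberTheory.EllipticCurves.Rank1Residual.GoodSS W' 3 ∧ W'.frobeniusTrace 3 = 0)
    (hsurj : W'.HasSurjectiveModNGaloisRep 3) (hN : W'.conductorNorm ℤ = N')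
    (hK' : Literature.NumberTheory.EllipticCurves.IsImaginaryQuadratic K)
    (hH : Literature.NumberTheory.EllipticCurves.SatisfiesHeegnerHypothesis N' K) (hodd : Odd (NumberField.discr K))
    (κ : Literature.NumberTheory.EllipticCurves.ZpExtension K 3) (hκ : κ.IsAnticyclotomic)
    (γ : Field.absoluteGaloisGroup K) [Fact (κ.IsTopGenerator γ)]
    (𝔭 : IsDedekindDomain.HeightOneSpectrum (NumberField.RingOfIntegers K))
    (h𝔭 : ((3 : ℕ) : NumberField.RingOfIntegers K) ∈ 𝔭.asIdeal)
    (he : 𝔭.asIdeal.ramificationIdx (NumberField.RingOfIntegers ℚ) = 1)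
    (hf : 𝔭.asIdeal.inertiaDeg (NumberField.RingOfIntegers ℚ) = 1)
    (𝔭' : IsDedekindDomain.HeightOneSpectrum (NumberField.RingOfIntegers K))
    (h𝔭' : ((3 : ℕ) : NumberField.RingOfIntegers K) ∈ 𝔭'.asIdeal) (hne : 𝔭' ≠ 𝔭)
    (ι' : PadicAlgCl 3 ≃+* ℂ)
    (hι : Summit.BirchSwinnertonDyer.BirchSwinnertonDyer.Theorems.SchneiderFree.BranchInducesPrime 3 ι' 𝔭)
    (ΩK : ℂ) (Ωp : ℂ_[3]) (L' : Literature.NumberTheory.EllipticCurves.UnrSeries 3) (hΩK : ΩK ≠ 0) (hΩp : Ωp ≠ 0)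
    (hL : Literature.NumberTheory.EllipticCurves.IsBDPLFunction ι' 𝔭 κ γ Dt'.f ΩK Ωp L')
    (hμ : ∃ i : ℕ, ‖((PowerSeries.coeff i L' : unrIntegers 3) : ℂ_[3])‖ = 1) :
    Module.IsTorsion (IwasawaAlgebra 3)
        (Summit.BirchSwinnertonDyer.Rank1Residual.X11b.AcSelmer.XAc (W'.baseChange K) 3 κ 𝔭' ∅ γ) ∧
      ∃ g' : UnrSeries 3,
        (Summit.BirchSwinnertonDyer.Rank1Residual.X11b.AcSelmer.XAc.charIdeal (W'.baseChange K) 3 κ 𝔭' ∅ γ).map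
            (PowerSeries.map (Summit.BirchSwinnertonDyer.Rank1Residual.X11b.Halves.toUnr 3)) = Ideal.span {g'} ∧
          ∃ i : ℕ, ‖((PowerSeries.coeff i g' : unrIntegers 3) : ℂ_[3])‖ = 1 := by
  have hroots : ∀ m : ℕ, 1 ≤ m → ∃ ζ : ℂ_[3], IsPrimitiveRoot ζ (3 ^ m) :=
    fun m _ ↦ exists_isPrimitiveRoot_padicComplex m
  have hval : ∀ (L : UnrSeries 3) (m : ℕ), 1 ≤ m → ∀ ζ : ℂ_[3], IsPrimitiveRoot ζ (3 ^ m) →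
      ∃ v, L.HasValueAt (ζ - 1) v := by
    intro L m hm ζ hζ
    refine exists_hasValueAt L ?_
    -- ‖ζ - 1‖ ^ φ(3^m) = 3⁻¹ < 1 with φ(3^m) ≥ 1 forces ‖ζ - 1‖ < 1
    have hφ := primitiveRootNormAtThree_holds m hm ζ hζ
    by_contra hge
    push_neg at hge
    have : (1 : ℝ) ≤ ‖ζ - 1‖ ^ Nat.totient (3 ^ m) := one_le_pow₀ hge
    rw [hφ] at this
    norm_num at this
  exact conclusion_of_frequentlyBoundedCharLayers (W'.baseChange K) κ 𝔭' γ
    (frequentlyBoundedCharLayers_of_squeezeSparse hK hP1 primitiveRootNormAtThree_holds hroots hval W' N' K Dt' hbucket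
      hsurj hN
      hK' hH hodd κ hκ γ 𝔭 h𝔭 he hf 𝔭' h𝔭' hne ι' hι ΩK Ωp L' hΩK hΩp hL hμ)

/-! ### §7 P1 PROVED (elementary ultrametric estimate — no Weierstrass preparation, no discreteness of `R₀`) -/

/-- **TRANSFER along sparse levels (PROVED, concludes the crux BY NAME): `C⁺_sparse → (frame ∧ analytic μ = 0) → TwinAlgMuZeroAtThree`.** -/
theorem TwinAlgMuZeroAtThree_of_onePointSqueezeSparse (hK : TwistedOnePointKolyvaginAtThreeSparse)
    (hS : TwinFrameMuSupplyAtThree) :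
    Summit.BirchSwinnertonDyer.BirchSwinnertonDyer.Theses.UniversalToricDescent.TwinAlgMuZeroAtThree := by
  intro W' _ _ N' _ K _ _ Dt' hbucket hsurj hN hK' hH hodd κ hκ γ _ 𝔭 h𝔭 he hf 𝔭' h𝔭' hne
  obtain ⟨ι', hι, ΩK, Ωp, L', hΩK, hΩp, hL, hμ⟩ :=
    hS W' N' K Dt' hbucket hsurj hN hK' hH hodd κ hκ γ 𝔭 h𝔭 he hf 𝔭' h𝔭' hne
  exact twinAlgMuZero_conclusion_of_squeezeSparse hK unitCoeffValuesAtTorsionPoints_holds W' N' K Dt' hbucket hsurj hN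
    hK' hH hodd κ hκ γ 𝔭 h𝔭 he hf 𝔭' h𝔭' hne ι' hι ΩK Ωp L' hΩK hΩp hL hμ


/-! ### §11 (g65) P2′ PROVED — sub-linear (even sparse sub-linear) character layers force `X/3X` finite

No structure theory is needed.  Write `M_n = (Tⁿ,3)X`.  The chain `M_0 ⊇ M_1 ⊇ ⋯` has successive quotients killed by `3`
(`3·M_n ⊆ 3X ⊆ M_{n+1}`), so every STRICT step multiplies `#(X/M_n)` by at least `3`; if no step were an equality we would get
`#(X/M_n) ≥ 3ⁿ` for all `n`, and at `n = φ(3^m)` (where `X/M_n` is a quotient of the character layer `X/Φ_m X`, because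
`Φ_m ≡ T^{φ(3^m)} (mod 3)`) this contradicts `#(X/Φ_m X) ≤ 3^{c·φ(3^m)+B}` with `c < 1` as soon as `(1-c)·φ(3^m) > B`.  Hence
some step is an equality `M_n = M_{n+1}`, and the Nakayama tail of P2's proof (`T ∈ rad Λ`) gives `M_n = 3X`, i.e. `X/3X` finite.
The bound is needed only along an UNBOUNDED set of levels `m` (sparse) and tolerates any error `c·φ(3^m) + O(1)`, `c < 1` — in
particular every error that is `o(φ(3^m))` (e.g. `O(m)`: Gauss sums, `χ(pⁿ)p⁻ⁿ`, logarithm denominators, norm indices of formal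
groups in the ramified layers, all of size `O(log conductor)`). -/

/-- The `(Tⁿ,3)`-layer submodule `M_n = (Tⁿ,3)·X`. -/
abbrev layerSub (X : Type) [AddCommGroup X] [Module (IwasawaAlgebra 3) X] (n : ℕ) :
    Submodule (IwasawaAlgebra 3) X :=
  layerIdeal n • ⊤

theorem layerSub_anti (X : Type) [AddCommGroup X] [Module (IwasawaAlgebra 3) X] {n N : ℕ} (h : n ≤ N) :
    layerSub X N ≤ layerSub X n :=
  Submodule.smul_mono_left (layerIdeal_anti h)

/-- Character layers SUB-LINEAR ALONG AN UNBOUNDED SET OF LEVELS: `∃ c < 1, ∃ B, ∀ m₁ ∃ m ≥ m₁, #(X/Φ_m X) ≤ 3^{c·φ(3^m)+B}`.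
This is the weakest layer-growth hypothesis the endgame accepts (it contains `BoundedCharLayers`, `SublinearCharLayers` and
`FrequentlyBoundedCharLayers`). -/
def FrequentlySublinearCharLayers (X : Type) [AddCommGroup X] [Module (IwasawaAlgebra 3) X] : Prop :=
  ∃ c : ℝ, c < 1 ∧ ∃ B : ℕ, ∀ m₁ : ℕ, ∃ m : ℕ, m₁ ≤ m ∧ Finite (CharLayer X m) ∧
    (Nat.card (CharLayer X m) : ℝ) ≤ (3 : ℝ) ^ (c * (Nat.totient (3 ^ m) : ℝ) + (B : ℝ))

theorem frequentlySublinear_of_sublinear (X : Type) [AddCommGroup X] [Module (IwasawaAlgebra 3) X]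
    (h : SublinearCharLayers X) : FrequentlySublinearCharLayers X := by
  obtain ⟨c, hc, B, m₀, h⟩ := h
  exact ⟨c, hc, B, fun m₁ ↦ ⟨max m₀ m₁, le_max_right _ _, h _ (le_max_left _ _)⟩⟩

/-- NAKAYAMA TAIL (the body of P2's proof): ONE finite `(Tⁿ,3)`-layer with `M_n ⊆ M_{n+1}` forces `X/3X` finite. -/
theorem finite_augQuot_of_stableLayer (X : Type) [AddCommGroup X] [Module (IwasawaAlgebra 3) X]
    [Module.Finite (IwasawaAlgebra 3) X] (n : ℕ)
    (hfin : Finite (X ⧸ layerSub X n))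
    (hge : layerSub X n ≤ layerSub X (n + 1)) :
    Finite (X ⧸ (augIdealP 3 • (⊤ : Submodule (IwasawaAlgebra 3) X))) := by
  set P3 : Submodule (IwasawaAlgebra 3) X := Ideal.span {(3 : IwasawaAlgebra 3)} • ⊤ with hP3
  set N : Submodule (IwasawaAlgebra 3) (X ⧸ P3) :=
    Ideal.span {(PowerSeries.X ^ n : IwasawaAlgebra 3)} • ⊤ with hN
  have hXn : ∀ x : X, ∃ w w' : X, (PowerSeries.X ^ n : IwasawaAlgebra 3) • x =
      (PowerSeries.X ^ (n + 1) : IwasawaAlgebra 3) • w + (3 : IwasawaAlgebra 3) • w' := by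
    intro x
    have hx : (PowerSeries.X ^ n : IwasawaAlgebra 3) • x ∈ layerIdeal (n + 1) • (⊤ : Submodule _ X) :=
      hge (Submodule.smul_mem_smul (X_pow_mem_layerIdeal n) Submodule.mem_top)
    exact mem_span_pair_smul_top hx
  have hNle : N ≤ Ideal.span {(PowerSeries.X : IwasawaAlgebra 3)} • N := by
    rw [hN, Submodule.smul_le]
    intro r hr y _
    obtain ⟨a, rfl⟩ := Ideal.mem_span_singleton'.1 hr
    rw [mul_smul]
    refine Submodule.smul_mem _ a ?_
    induction y using Submodule.Quotient.induction_on with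
    | H x =>
      obtain ⟨w, w', hw⟩ := hXn x
      rw [← Submodule.Quotient.mk_smul, hw, Submodule.Quotient.mk_add, Submodule.Quotient.mk_smul,
        Submodule.Quotient.mk_smul]
      have h3w : (Submodule.Quotient.mk ((3 : IwasawaAlgebra 3) • w') : X ⧸ P3) = 0 := by
        rw [Submodule.Quotient.mk_eq_zero, hP3]
        exact Submodule.smul_mem_smul (Ideal.subset_span rfl) Submodule.mem_top
      rw [Submodule.Quotient.mk_smul] at h3w
      rw [h3w, add_zero, pow_succ, mul_comm, mul_smul]
      exact Submodule.smul_mem_smul (Ideal.subset_span rfl)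
        (Submodule.smul_mem_smul (Ideal.subset_span rfl) Submodule.mem_top)
  have hNfg : N.FG := by
    haveI : IsNoetherian (IwasawaAlgebra 3) (X ⧸ P3) := isNoetherian_of_isNoetherianRing_of_finite _ _
    exact IsNoetherian.noetherian N
  have hN0 : N = ⊥ := Submodule.eq_bot_of_le_smul_of_le_jacobson_bot _ N hNfg hNle span_X_le_jacobson_bot
  have hXn3 : ∀ x : X, (PowerSeries.X ^ n : IwasawaAlgebra 3) • x ∈ P3 := by
    intro x
    have : (Submodule.Quotient.mk ((PowerSeries.X ^ n : IwasawaAlgebra 3) • x) : X ⧸ P3) ∈ N := by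
      rw [Submodule.Quotient.mk_smul, hN]
      exact Submodule.smul_mem_smul (Ideal.subset_span rfl) Submodule.mem_top
    rw [hN0, Submodule.mem_bot] at this
    exact (Submodule.Quotient.mk_eq_zero P3).1 this
  have hEq : layerSub X n = P3 := by
    apply le_antisymm
    · rw [Submodule.smul_le]
      intro r hr x _
      obtain ⟨a, b, rfl⟩ := Ideal.mem_span_pair.1 hr
      rw [add_smul, mul_smul, mul_smul]
      exact P3.add_mem (P3.smul_mem a (hXn3 x))
        (P3.smul_mem b (Submodule.smul_mem_smul (Ideal.subset_span rfl) Submodule.mem_top))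
    · exact Submodule.smul_mono_left
        ((Ideal.span_singleton_le_iff_mem _).2 (three_mem_layerIdeal n))
  have hC : (PowerSeries.C ((3 : ℕ) : ℤ_[3]) : IwasawaAlgebra 3) = 3 := by
    rw [map_natCast, Nat.cast_ofNat]
  change Finite (X ⧸ (Ideal.span {PowerSeries.C ((3 : ℕ) : ℤ_[3])} • (⊤ : Submodule (IwasawaAlgebra 3) X)))
  rw [hC, ← hP3, ← hEq]
  exact hfin

/-- A STRICT step `M_{n+1} ⊊ M_n` costs a factor `≥ 3`: the quotient `M_n/M_{n+1}` is a nonzero group killed by `3`. -/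
theorem three_mul_card_le_of_strict (X : Type) [AddCommGroup X] [Module (IwasawaAlgebra 3) X] (n : ℕ)
    [hf : Finite (X ⧸ layerSub X (n + 1))] (hne : ¬ layerSub X n ≤ layerSub X (n + 1)) :
    3 * Nat.card (X ⧸ layerSub X n) ≤ Nat.card (X ⧸ layerSub X (n + 1)) := by
  have hle : layerSub X (n + 1) ≤ layerSub X n := layerSub_anti X (Nat.le_succ n)
  rw [← Submodule.card_quotient_mul_card_quotient (layerSub X n) (layerSub X (n + 1)) hle]
  refine Nat.mul_le_mul_right _ ?_
  obtain ⟨x, hx, hxn⟩ := SetLike.not_le_iff_exists.1 hne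
  set G : Submodule (IwasawaAlgebra 3) (X ⧸ layerSub X (n + 1)) := (layerSub X n).map (layerSub X (n + 1)).mkQ
    with hG
  set q : X ⧸ layerSub X (n + 1) := (layerSub X (n + 1)).mkQ x with hq
  have hqG : q ∈ G := Submodule.mem_map_of_mem hx
  have hq0 : q ≠ 0 := by
    intro h
    rw [hq, Submodule.mkQ_apply, Submodule.Quotient.mk_eq_zero] at h
    exact hxn h
  have hqqq : q + q + q = 0 := by
    have h3 : (3 : IwasawaAlgebra 3) • x ∈ layerSub X (n + 1) :=
      Submodule.smul_mem_smul (three_mem_layerIdeal (n + 1)) Submodule.mem_top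
    have : q + q + q = (layerSub X (n + 1)).mkQ ((3 : IwasawaAlgebra 3) • x) := by
      rw [show (3 : IwasawaAlgebra 3) = 1 + 1 + 1 by norm_num, add_smul, add_smul, one_smul, map_add, map_add]
    rw [this, Submodule.mkQ_apply, Submodule.Quotient.mk_eq_zero]
    exact h3
  have hqq0 : q + q ≠ 0 := by
    intro h
    apply hq0
    have : q = (q + q + q) - (q + q) := by abel
    rw [this, hqqq, h, sub_zero]
  have hqq1 : q ≠ q + q := by
    intro h
    apply hq0
    have : q = (q + q) - q := by abel
    rw [this, ← h, sub_self]
  classical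
  let g : G := ⟨q, hqG⟩
  let g2 : G := ⟨q + q, G.add_mem hqG hqG⟩
  haveI : Fintype G := Fintype.ofFinite G
  have hcard : ({0, g, g2} : Finset G).card = 3 := by
    have h01 : (0 : G) ≠ g := fun h ↦ hq0 (congrArg Subtype.val h).symm
    have h02 : (0 : G) ≠ g2 := fun h ↦ hqq0 (congrArg Subtype.val h).symm
    have h12 : g ≠ g2 := fun h ↦ hqq1 (congrArg Subtype.val h)
    rw [Finset.card_insert_of_notMem, Finset.card_pair h12]
    simp only [Finset.mem_insert, Finset.mem_singleton, not_or]
    exact ⟨h01, h02⟩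
  calc 3 = ({0, g, g2} : Finset G).card := hcard.symm
    _ ≤ Finset.univ.card := Finset.card_le_univ _
    _ = Nat.card G := by rw [Finset.card_univ, Nat.card_eq_fintype_card]

/-- If NO step of the chain is an equality, `#(X/M_n) ≥ 3ⁿ`. -/
theorem pow_le_card_layer_of_strict (X : Type) [AddCommGroup X] [Module (IwasawaAlgebra 3) X]
    (hfin : ∀ n, Finite (X ⧸ layerSub X n)) (hstrict : ∀ n, ¬ layerSub X n ≤ layerSub X (n + 1)) (n : ℕ) :
    3 ^ n ≤ Nat.card (X ⧸ layerSub X n) := by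
  induction n with
  | zero =>
    haveI := hfin 0
    haveI : Nonempty (X ⧸ layerSub X 0) := ⟨0⟩
    rw [pow_zero]
    exact Nat.card_pos
  | succ k ih =>
    haveI := hfin (k + 1)
    calc 3 ^ (k + 1) = 3 * 3 ^ k := by ring
      _ ≤ 3 * Nat.card (X ⧸ layerSub X k) := Nat.mul_le_mul_left _ ih
      _ ≤ Nat.card (X ⧸ layerSub X (k + 1)) := three_mul_card_le_of_strict X k (hstrict k)

theorem totient_three_pow (m : ℕ) (hm : 1 ≤ m) : Nat.totient (3 ^ m) = 2 * 3 ^ (m - 1) := by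
  rw [Nat.totient_prime_pow Nat.prime_three (by omega)]
  ring

/-- **P2′ PROVED (sparse form).** Frequently sub-linear character layers of a f.g. `Λ`-module force `X/3X` finite. -/
theorem finite_augQuot_of_frequentlySublinearCharLayers (X : Type) [AddCommGroup X] [Module (IwasawaAlgebra 3) X]
    [Module.Finite (IwasawaAlgebra 3) X] (hX : FrequentlySublinearCharLayers X) :
    Finite (X ⧸ (augIdealP 3 • (⊤ : Submodule (IwasawaAlgebra 3) X))) := by
  obtain ⟨c, hc, B, hB⟩ := hX
  -- every `(Tⁿ,3)`-layer is finite (a quotient of a finite character layer of high level)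
  have hfin : ∀ n, Finite (X ⧸ layerSub X n) := by
    intro n
    obtain ⟨m, hm, hfinm, -⟩ := hB (n + 1)
    have hm1 : 1 ≤ m := by omega
    have hnN : n ≤ 2 * 3 ^ (m - 1) := by
      have h1 : m - 1 < 3 ^ (m - 1) := Nat.lt_pow_self (by norm_num)
      omega
    exact (finite_quot_of_le (X := X) ((span_cycLayer_le _ hm1).trans (layerIdeal_anti hnN)) hfinm).1
  by_cases hstab : ∃ n, layerSub X n ≤ layerSub X (n + 1)
  · obtain ⟨n, hn⟩ := hstab
    exact finite_augQuot_of_stableLayer X n (hfin n) hn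
  push_neg at hstab
  exfalso
  obtain ⟨N, hN⟩ := exists_nat_gt ((B : ℝ) / (1 - c))
  obtain ⟨m, hm, hfinm, hcard⟩ := hB (N + 1)
  have hm1 : 1 ≤ m := by omega
  have hφeq : Nat.totient (3 ^ m) = 2 * 3 ^ (m - 1) := totient_three_pow m hm1
  set φ := Nat.totient (3 ^ m) with hφ
  have hNφ : N < φ := by
    have h1 : m - 1 < 3 ^ (m - 1) := Nat.lt_pow_self (by norm_num)
    omega
  have hlow : 3 ^ φ ≤ Nat.card (X ⧸ layerSub X φ) := pow_le_card_layer_of_strict X hfin hstab φ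
  have hmid : Nat.card (X ⧸ layerSub X φ) ≤ Nat.card (CharLayer X m) :=
    (finite_quot_of_le (X := X) ((span_cycLayer_le _ hm1).trans (layerIdeal_anti hφeq.le)) hfinm).2
  have hreal : (3 : ℝ) ^ (φ : ℝ) ≤ (3 : ℝ) ^ (c * (φ : ℝ) + (B : ℝ)) := by
    calc (3 : ℝ) ^ (φ : ℝ) = ((3 ^ φ : ℕ) : ℝ) := by rw [Real.rpow_natCast]; push_cast; rfl
      _ ≤ (Nat.card (X ⧸ layerSub X φ) : ℝ) := by exact_mod_cast hlow
      _ ≤ (Nat.card (CharLayer X m) : ℝ) := by exact_mod_cast hmid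
      _ ≤ (3 : ℝ) ^ (c * (φ : ℝ) + (B : ℝ)) := hcard
  have hexp : (φ : ℝ) ≤ c * (φ : ℝ) + (B : ℝ) := (Real.rpow_le_rpow_left_iff (by norm_num)).1 hreal
  have h1c : (0 : ℝ) < 1 - c := by linarith
  have hNr : (B : ℝ) < (N : ℝ) * (1 - c) := (div_lt_iff₀ h1c).1 hN
  have hNφr : (N : ℝ) < (φ : ℝ) := by exact_mod_cast hNφ
  nlinarith [mul_lt_mul_of_pos_right hNφr h1c]

/-- **P2′ PROVED** (the support Prop `SublinearCharLayersCriterion` typed in §9). -/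
theorem sublinearCharLayersCriterion_holds : SublinearCharLayersCriterion := by
  intro X _ _ _ hX
  exact finite_augQuot_of_frequentlySublinearCharLayers X (frequentlySublinear_of_sublinear X hX)


/-- `FrequentlyBoundedCharLayers ⟹ FrequentlySublinearCharLayers` (`c = 0`; PROVED). -/
theorem frequentlySublinear_of_frequentlyBounded (X : Type) [AddCommGroup X] [Module (IwasawaAlgebra 3) X]
    (h : FrequentlyBoundedCharLayers X) : FrequentlySublinearCharLayers X := by
  obtain ⟨B, h⟩ := h
  refine ⟨0, zero_lt_one, B, fun m₁ ↦ ?_⟩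
  obtain ⟨m, hm, hf, hc⟩ := h m₁
  refine ⟨m, hm, hf, ?_⟩
  rw [zero_mul, zero_add, Real.rpow_natCast]
  exact_mod_cast hc

/-- Endgame from frequently sub-linear layers on the crux's object (PROVED). -/
theorem conclusion_of_frequentlySublinearCharLayers {K : Type} [Field K] [NumberField K] (W : WeierstrassCurve K)
    [W.IsElliptic] (κ : ZpExtension K 3) (𝔭 : HeightOneSpectrum (𝓞 K)) (γ : absoluteGaloisGroup K)
    [Fact (κ.IsTopGenerator γ)] (hX : FrequentlySublinearCharLayers (XAc W 3 κ 𝔭 ∅ γ)) :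
    Module.IsTorsion (IwasawaAlgebra 3) (XAc W 3 κ 𝔭 ∅ γ) ∧
      ∃ g : UnrSeries 3,
        (XAc.charIdeal W 3 κ 𝔭 ∅ γ).map (PowerSeries.map (Halves.toUnr 3)) = Ideal.span {g} ∧
          ∃ i : ℕ, ‖((PowerSeries.coeff i g : unrIntegers 3) : ℂ_[3])‖ = 1 := by
  haveI := XAc.module_finite κ 𝔭 ∅ γ Set.finite_empty (W := W)
  have hfin := finite_augQuot_of_frequentlySublinearCharLayers (XAc W 3 κ 𝔭 ∅ γ) hX
  have hfg := moduleFinite_padicInt_of_finite_quotient_augIdealP 3 (XAc W 3 κ 𝔭 ∅ γ) hfin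
  exact isTorsion_and_exists_generator_of_finite_pTorsion W 3 κ 𝔭 ∅ γ Set.finite_empty
    (finite_pTorsion_of_moduleFinite_padicInt W 3 κ 𝔭 ∅ γ hfg)

/-- **SLACK TRANSFER, NOW UNCONDITIONAL IN THE ALGEBRA (PROVED): `C⁺_slack → (frame ∧ analytic μ = 0) → TwinAlgMuZeroAtThree`.** -/
theorem TwinAlgMuZeroAtThree_of_onePointSqueezeSlack' (hK : TwistedOnePointKolyvaginAtThreeSlack)
    (hS : TwinFrameMuSupplyAtThree) :
    Summit.BirchSwinnertonDyer.BirchSwinnertonDyer.Theses.UniversalToricDescent.TwinAlgMuZeroAtThree :=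
  TwinAlgMuZeroAtThree_of_onePointSqueezeSlack sublinearCharLayersCriterion_holds hK hS

/-- **K1_weak = `C⁺_weak`** (sparse ∧ slack — the weakest transfer): the one-point squeeze with error `3^{c·φ(3^m)+B}`, some
`c < 1`, asserted only along an UNBOUNDED set of levels `m` (same binders as `C⁺`). -/
def TwistedOnePointKolyvaginAtThreeWeak : Prop :=
  ∀ (W' : WeierstrassCurve ℚ) [W'.IsElliptic] [W'.IsGloballyMinimal] (N' : ℕ) [NeZero N'] (K : Type) [Field K]
    [NumberField K] (Dt' : Literature.NumberTheory.EllipticCurves.ModularForms.ModularParametrizationData W' N'),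
    (Literature.NumberTheory.EllipticCurves.Rank1Residual.Mult W' 3 ∧ ¬ 3 ∣ padicValInt 3 W'.minimalDiscriminantInt ∨
      Literature.NumberTheory.EllipticCurves.Rank1Residual.GoodSS W' 3 ∧ W'.frobeniusTrace 3 = 0) →
    W'.HasSurjectiveModNGaloisRep 3 → W'.conductorNorm ℤ = N' →
    Literature.NumberTheory.EllipticCurves.IsImaginaryQuadratic K →
    Literature.NumberTheory.EllipticCurves.SatisfiesHeegnerHypothesis N' K → Odd (NumberField.discr K) →
    ∀ (κ : Literature.NumberTheory.EllipticCurves.ZpExtension K 3), κ.IsAnticyclotomic →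
    ∀ (γ : Field.absoluteGaloisGroup K) [Fact (κ.IsTopGenerator γ)]
      (𝔭 : IsDedekindDomain.HeightOneSpectrum (NumberField.RingOfIntegers K)),
      ((3 : ℕ) : NumberField.RingOfIntegers K) ∈ 𝔭.asIdeal →
      𝔭.asIdeal.ramificationIdx (NumberField.RingOfIntegers ℚ) = 1 →
      𝔭.asIdeal.inertiaDeg (NumberField.RingOfIntegers ℚ) = 1 →
    ∀ (𝔭' : IsDedekindDomain.HeightOneSpectrum (NumberField.RingOfIntegers K)),
      ((3 : ℕ) : NumberField.RingOfIntegers K) ∈ 𝔭'.asIdeal → 𝔭' ≠ 𝔭 →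
    ∀ (ι' : PadicAlgCl 3 ≃+* ℂ),
      Summit.BirchSwinnertonDyer.BirchSwinnertonDyer.Theorems.SchneiderFree.BranchInducesPrime 3 ι' 𝔭 →
    ∀ (ΩK : ℂ) (Ωp : ℂ_[3]) (L' : Literature.NumberTheory.EllipticCurves.UnrSeries 3), ΩK ≠ 0 → Ωp ≠ 0 →
      Literature.NumberTheory.EllipticCurves.IsBDPLFunction ι' 𝔭 κ γ Dt'.f ΩK Ωp L' →    ∃ c : ℝ, c < 1 ∧ ∃ B : ℕ, ∀ m₁ : ℕ, ∃ m : ℕ, m₁ ≤ m ∧ ∀ ζ : ℂ_[3], IsPrimitiveRoot ζ (3 ^ m) → ∀ v : ℂ_[3],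
      L'.HasValueAt (ζ - 1) v → v ≠ 0 →
      Finite (CharLayer (Summit.BirchSwinnertonDyer.Rank1Residual.X11b.AcSelmer.XAc (W'.baseChange K) 3 κ 𝔭' ∅ γ) m) ∧
        (Nat.card (CharLayer (Summit.BirchSwinnertonDyer.Rank1Residual.X11b.AcSelmer.XAc (W'.baseChange K) 3 κ 𝔭' ∅ γ) m) : ℝ)
          * ‖v‖ ^ Nat.totient (3 ^ m) ≤ (3 : ℝ) ^ (c * (Nat.totient (3 ^ m) : ℝ) + (B : ℝ))

/-- `C⁺_slack ⟹ C⁺_weak` (PROVED). -/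
theorem weak_of_slack (hK : TwistedOnePointKolyvaginAtThreeSlack) : TwistedOnePointKolyvaginAtThreeWeak := by
  intro W' _ _ N' _ K _ _ Dt' hb hs hN hK' hH ho κ hκ γ _ 𝔭 h1 h2 h3 𝔭' h4 h5 ι' hι ΩK Ωp L' hΩK hΩp hL
  obtain ⟨c, hc, B, m₀, h⟩ := hK W' N' K Dt' hb hs hN hK' hH ho κ hκ γ 𝔭 h1 h2 h3 𝔭' h4 h5 ι' hι ΩK Ωp L' hΩK hΩp hL
  exact ⟨c, hc, B, fun m₁ ↦ ⟨max m₀ m₁, le_max_right _ _, h _ (le_max_left _ _)⟩⟩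

/-- `C⁺_sparse ⟹ C⁺_weak` (PROVED). -/
theorem weak_of_sparse (hK : TwistedOnePointKolyvaginAtThreeSparse) : TwistedOnePointKolyvaginAtThreeWeak := by
  intro W' _ _ N' _ K _ _ Dt' hb hs hN hK' hH ho κ hκ γ _ 𝔭 h1 h2 h3 𝔭' h4 h5 ι' hι ΩK Ωp L' hΩK hΩp hL
  obtain ⟨B, h⟩ := hK W' N' K Dt' hb hs hN hK' hH ho κ hκ γ 𝔭 h1 h2 h3 𝔭' h4 h5 ι' hι ΩK Ωp L' hΩK hΩp hL
  refine ⟨0, zero_lt_one, B, fun m₁ ↦ ?_⟩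
  obtain ⟨m, hm, hBm⟩ := h m₁
  refine ⟨m, hm, fun ζ hζ v hv hv0 ↦ ?_⟩
  obtain ⟨hf, hi⟩ := hBm ζ hζ v hv hv0
  refine ⟨hf, ?_⟩
  rw [zero_mul, zero_add, Real.rpow_natCast]
  exact hi

/-- `C⁺ ⟹ C⁺_weak` (PROVED). -/
theorem weak_of_C_plus (hK : TwistedOnePointKolyvaginAtThree) : TwistedOnePointKolyvaginAtThreeWeak :=
  weak_of_sparse (sparse_of_C_plus hK)

/-- **THE SQUEEZE, weakest form (PROVED): `C⁺_weak` + P1 + P0 ⟹ frequently sub-linear character layers of `X′`.** -/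
theorem frequentlySublinearCharLayers_of_squeezeWeak (hK : TwistedOnePointKolyvaginAtThreeWeak)
    (hP1 : UnitCoeffValuesAtTorsionPoints) (hP0 : PrimitiveRootNormAtThree)
    (hroots : ∀ m : ℕ, 1 ≤ m → ∃ ζ : ℂ_[3], IsPrimitiveRoot ζ (3 ^ m))
    (hval : ∀ (L : UnrSeries 3) (m : ℕ), 1 ≤ m → ∀ ζ : ℂ_[3], IsPrimitiveRoot ζ (3 ^ m) → ∃ v, L.HasValueAt (ζ - 1) v)
    (W' : WeierstrassCurve ℚ) [W'.IsElliptic] [W'.IsGloballyMinimal] (N' : ℕ) [NeZero N'] (K : Type) [Field K]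
    [NumberField K] (Dt' : Literature.NumberTheory.EllipticCurves.ModularForms.ModularParametrizationData W' N')
    (hbucket : Literature.NumberTheory.EllipticCurves.Rank1Residual.Mult W' 3 ∧
        ¬ 3 ∣ padicValInt 3 W'.minimalDiscriminantInt ∨
      Literature.NumberTheory.EllipticCurves.Rank1Residual.GoodSS W' 3 ∧ W'.frobeniusTrace 3 = 0)
    (hsurj : W'.HasSurjectiveModNGaloisRep 3) (hN : W'.conductorNorm ℤ = N')
    (hK' : Literature.NumberTheory.EllipticCurves.IsImaginaryQuadratic K)
    (hH : Literature.NumberTheory.EllipticCurves.SatisfiesHeegnerHypothesis N' K) (hodd : Odd (NumberField.discr K))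
    (κ : Literature.NumberTheory.EllipticCurves.ZpExtension K 3) (hκ : κ.IsAnticyclotomic)
    (γ : Field.absoluteGaloisGroup K) [Fact (κ.IsTopGenerator γ)]
    (𝔭 : IsDedekindDomain.HeightOneSpectrum (NumberField.RingOfIntegers K))
    (h𝔭 : ((3 : ℕ) : NumberField.RingOfIntegers K) ∈ 𝔭.asIdeal)
    (he : 𝔭.asIdeal.ramificationIdx (NumberField.RingOfIntegers ℚ) = 1)
    (hf : 𝔭.asIdeal.inertiaDeg (NumberField.RingOfIntegers ℚ) = 1)
    (𝔭' : IsDedekindDomain.HeightOneSpectrum (NumberField.RingOfIntegers K))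
    (h𝔭' : ((3 : ℕ) : NumberField.RingOfIntegers K) ∈ 𝔭'.asIdeal) (hne : 𝔭' ≠ 𝔭)
    (ι' : PadicAlgCl 3 ≃+* ℂ)
    (hι : Summit.BirchSwinnertonDyer.BirchSwinnertonDyer.Theorems.SchneiderFree.BranchInducesPrime 3 ι' 𝔭)
    (ΩK : ℂ) (Ωp : ℂ_[3]) (L' : Literature.NumberTheory.EllipticCurves.UnrSeries 3) (hΩK : ΩK ≠ 0) (hΩp : Ωp ≠ 0)
    (hL : Literature.NumberTheory.EllipticCurves.IsBDPLFunction ι' 𝔭 κ γ Dt'.f ΩK Ωp L')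
    (hμ : ∃ i : ℕ, ‖((PowerSeries.coeff i L' : unrIntegers 3) : ℂ_[3])‖ = 1) :
    FrequentlySublinearCharLayers
      (Summit.BirchSwinnertonDyer.Rank1Residual.X11b.AcSelmer.XAc (W'.baseChange K) 3 κ 𝔭' ∅ γ) := by
  obtain ⟨c, hc, B, hB⟩ := hK W' N' K Dt' hbucket hsurj hN hK' hH hodd κ hκ γ 𝔭 h𝔭 he hf 𝔭' h𝔭' hne ι' hι ΩK Ωp L'
    hΩK hΩp hL
  obtain ⟨lam, m₁, hlam⟩ := hP1 L' hμ
  refine ⟨c, hc, B + lam, fun m₂ ↦ ?_⟩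
  obtain ⟨m, hm, hBm⟩ := hB (max (max m₂ m₁) 1)
  have hm₂ : m₂ ≤ m := le_trans (le_trans (le_max_left _ _) (le_max_left _ _)) hm
  have hm₁ : m₁ ≤ m := le_trans (le_trans (le_max_right _ _) (le_max_left _ _)) hm
  have hm1 : 1 ≤ m := le_trans (le_max_right _ _) hm
  obtain ⟨ζ, hζ⟩ := hroots m hm1
  obtain ⟨v, hv⟩ := hval L' m hm1 ζ hζ
  have hvne : v ≠ 0 := by
    intro h0
    have hn := hlam m hm₁ ζ hζ v hv
    rw [h0, norm_zero] at hn
    have hz : ‖ζ - 1‖ ≠ 0 := by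
      intro hz
      have h3 := hP0 m hm1 ζ hζ
      rw [hz, zero_pow (Nat.totient_pos.2 (pow_pos (by norm_num) m)).ne'] at h3
      norm_num at h3
    exact (pow_ne_zero lam hz) hn.symm
  obtain ⟨hfin, hineq⟩ := hBm ζ hζ v hv hvne
  exact ⟨m, hm₂, hfin, card_le_of_onePoint_slack hineq (hlam m hm₁ ζ hζ v hv) (hP0 m hm1 ζ hζ)⟩

/-- **WEAKEST TRANSFER (PROVED, concludes the crux BY NAME): `C⁺_weak → (frame ∧ analytic μ = 0) → TwinAlgMuZeroAtThree`.** -/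
theorem TwinAlgMuZeroAtThree_of_onePointSqueezeWeak (hK : TwistedOnePointKolyvaginAtThreeWeak)
    (hS : TwinFrameMuSupplyAtThree) :
    Summit.BirchSwinnertonDyer.BirchSwinnertonDyer.Theses.UniversalToricDescent.TwinAlgMuZeroAtThree := by
  intro W' _ _ N' _ K _ _ Dt' hbucket hsurj hN hK' hH hodd κ hκ γ _ 𝔭 h𝔭 he hf 𝔭' h𝔭' hne
  obtain ⟨ι', hι, ΩK, Ωp, L', hΩK, hΩp, hL, hμ⟩ :=
    hS W' N' K Dt' hbucket hsurj hN hK' hH hodd κ hκ γ 𝔭 h𝔭 he hf 𝔭' h𝔭' hne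
  have hroots : ∀ m : ℕ, 1 ≤ m → ∃ ζ : ℂ_[3], IsPrimitiveRoot ζ (3 ^ m) :=
    fun m _ ↦ exists_isPrimitiveRoot_padicComplex m
  have hval : ∀ (L : UnrSeries 3) (m : ℕ), 1 ≤ m → ∀ ζ : ℂ_[3], IsPrimitiveRoot ζ (3 ^ m) →
      ∃ v, L.HasValueAt (ζ - 1) v := by
    intro L m hm ζ hζ
    refine exists_hasValueAt L ?_
    have hφ := primitiveRootNormAtThree_holds m hm ζ hζ
    by_contra hge
    push_neg at hge
    have : (1 : ℝ) ≤ ‖ζ - 1‖ ^ Nat.totient (3 ^ m) := one_le_pow₀ hge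
    rw [hφ] at this
    norm_num at this
  exact conclusion_of_frequentlySublinearCharLayers (W'.baseChange K) κ 𝔭' γ
    (frequentlySublinearCharLayers_of_squeezeWeak hK unitCoeffValuesAtTorsionPoints_holds primitiveRootNormAtThree_holds
      hroots hval W' N' K Dt' hbucket hsurj hN hK' hH hodd κ hκ γ 𝔭 h𝔭 he hf 𝔭' h𝔭' hne ι' hι ΩK Ωp L' hΩK hΩp hL hμ)

/-! ### §13 (g65) THE SUPERSINGULAR (KOBAYASHI) DEFECT BUDGET AT `p = 3` — why the slack `c < 1` is exactly what is needed

**Finding of this generation (memo `LENS-MEMO-utd-idea-g65.md` §2 for the derivation).** At a primitive character `χ` of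
level `m` the local `f`-cohomology `H¹_f(K_𝔭, T_χ)/tors` is the `χ̄`-ISOTYPIC part `U_χ` of `Ê′(𝔪_{L_m}) ⊗ O_χ`
(inflation–restriction; `E′(L_m)[3] = 0` at good supersingular `3`), whereas the printed special-value formula
(Castella–Hsieh 2018 Thm. 4.8, `n ≥ 2`, ordinary-FREE, `p ∤ 2Nφ(N)`: `ℒ(χ) = 𝔤(χ_𝔭⁻¹)·p⁻ⁿ·χ_𝔭(pⁿ)·log_ω(R_χ z)`)
sees the RESOLVENT `R_χ(z) = Σ χ(σ) z^σ` and, through `v₃(log R_χ(d_m)) = n/2 = v₃(𝔤·p⁻ⁿ)⁻¹`, the index of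
`R_χ(z)` in the RESOLVENT line `O_χ·R_χ(Ê′(𝔪_{L_m}))`.  The two lines differ by the **Kobayashi defect**
`d_χ = length_{O_χ}(U_χ / O_χ·R_χ(Ê′(𝔪_{L_m})))`, which for the supersingular formal group with `a₃ = 0` over
layer `m` of ANY totally ramified `ℤ₃`-tower of `ℚ₃` (Kobayashi 2013 §3: relative Lubin–Tate towers `W[ϖ_n]`,
`ϖ ∈ ℤ₃` — these contain the anticyclotomic local tower at a split prime; generation of `Ê(𝔪_n)` by `d_{ε,n}`
and `Tr d_{ε,n+1}`, proof of Prop. 3.12, p. 58) is computed in the cyclic module `ℤ₃[Γ_m]·d_m ≅ ℤ₃[X]/(ω̃_m^{∓})`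
to be the total degree of the ABSENT cyclotomic levels: `d_χ = kobDefect 3 m + O(1)` below (model value: the resolvent of the
cyclic generator is `unit·(ω_m/F)(ζ_χ - 1)·`(isotypic generator), `F` the annihilator of `d_m`, and each lower-level factor has
`π`-valuation equal to its degree; the `O(1) ∈ {0,1}` records whether the trivial level lies under `d_m`, and the quotient
`N_m/ℤ₃[Γ_m]d_m` — no level-`m` character, bounded torsion — adds at most a bounded amount; the transfer of this value to
the anticyclotomic tower is unknown U2 of the card, ask F5; if `𝔭′` splits further in `K_s/K`, replace `m` by `m - s`).  Consequently a twisted Kolyvagin argument with the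
standard `f`-structure (Howard's DVR bound) yields
`#Sel_{∅,0}(K, W′_χ) · |L′(ζ-1)|^{φ(3^m)} ≤ 3^{2·d_χ + err_Kol(χ)}` and NOT `3^{O(1)}`:
the plain `C⁺` is false AS A METHOD at supersingular `3`, but `2·d_χ ≤ (3/4)·φ(3^m)` (slope `2p/(p²-1) = 3/4 < 1`
at `p = 3`; PROVED below from the recursion `d_{m+2} = d_m + φ(3^{m+1})`), so the squeeze survives through the
slack criterion P2′ of §11 with **Kolyvagin error budget `err_Kol(χ) ≤ c'·φ(3^m) + B`, any `c' < 1/4`** — typed as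
`TwistedKolyvaginWithKobayashiDefectAtThree` and transferred to the crux (PROVED). -/

/-- **Kobayashi defect** (cyclotomic model) at a primitive character of level `n`: the total degree
`Σ φ(p^k)` over the levels `1 ≤ k ≤ n-1` of parity OPPOSITE to `n` — the cyclotomic factors absent from the
cyclic module `ℤ_p[Γ_n]·d_n ≅ ℤ_p[X]/(ω̃_n^{∓})` generated by Kobayashi's point of level `n` (`a_p = 0`). -/
def kobDefect (p n : ℕ) : ℕ := ∑ k ∈ Finset.Ico 1 n, if k % 2 = n % 2 then 0 else Nat.totient (p ^ k)

theorem kobDefect_zero (p : ℕ) : kobDefect p 0 = 0 := by simp [kobDefect]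

theorem kobDefect_one (p : ℕ) : kobDefect p 1 = 0 := by simp [kobDefect]

/-- The recursion `d_{n+2} = d_n + φ(p^{n+1})` (PROVED). -/
theorem kobDefect_add_two (p n : ℕ) : kobDefect p (n + 2) = kobDefect p n + Nat.totient (p ^ (n + 1)) := by
  rcases Nat.eq_zero_or_pos n with rfl | hn
  · simp [kobDefect]
  · unfold kobDefect
    simp_rw [Nat.add_mod_right]
    rw [Finset.sum_Ico_succ_top (by omega), Finset.sum_Ico_succ_top (by omega)]
    have h1 : (n + 1) % 2 ≠ n % 2 := by omega
    simp [h1]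

/-- **Closed-form budget `(p+1)·d_n + 1 ≤ p^n`** (PROVED; equality for `n` even: `d_n = (p^n-1)/(p+1)`,
`d_n = p(p^{n-1}-1)/(p+1)` for `n` odd), i.e. `2·d_n/φ(p^n) ≤ 2p/(p²-1) < 1` for every prime `p ≥ 3`. -/
theorem succ_mul_kobDefect_le {p : ℕ} (hp : p.Prime) : ∀ n, (p + 1) * kobDefect p n + 1 ≤ p ^ n
  | 0 => by simp [kobDefect]
  | 1 => by simpa [kobDefect] using hp.one_lt.le
  | (n + 2) => by
      have ih := succ_mul_kobDefect_le hp n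
      obtain ⟨q, rfl⟩ : ∃ q, p = q + 1 := ⟨p - 1, by have := hp.one_lt; omega⟩
      rw [kobDefect_add_two, Nat.totient_prime_pow_succ hp, Nat.add_sub_cancel]
      have hpow : (q + 1) ^ (n + 2) = (q + 1) ^ n * ((q + 1) * (q + 1)) := by ring
      rw [hpow]
      nlinarith [ih, Nat.zero_le ((q + 1) ^ n), Nat.zero_le q, Nat.zero_le (kobDefect (q+1) n)]

/-- Small values at `p = 3` (PROVED): `d_2 = 2`, `d_3 = 6`, `d_4 = 20` (then `d_5 = 60`, `d_6 = 182` by the recursion);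
`2·d_m/φ(3^m) = 0.67, 0.67, 0.74, 0.74, 0.749 → 3/4`. -/
theorem kobDefect_three_values : kobDefect 3 2 = 2 ∧ kobDefect 3 3 = 6 ∧ kobDefect 3 4 = 20 := by
  refine ⟨by decide, by decide, ?_⟩
  rw [kobDefect_add_two, Nat.totient_prime_pow_succ Nat.prime_three]
  decide

/-- **THE `p = 3` BUDGET (PROVED): `2·d_m ≤ (3/4)·φ(3^m)`** — the defect eats three quarters of the linear scale,
leaving a quarter of `φ(3^m)` for the Kolyvagin error. -/
theorem two_mul_kobDefect_three_le (m : ℕ) :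
    2 * (kobDefect 3 m : ℝ) ≤ 3 / 4 * (Nat.totient (3 ^ m) : ℝ) := by
  rcases Nat.eq_zero_or_pos m with rfl | hm
  · norm_num [kobDefect]
  · obtain ⟨k, rfl⟩ : ∃ k, m = k + 1 := ⟨m - 1, by omega⟩
    have h := succ_mul_kobDefect_le Nat.prime_three (k + 1)
    rw [Nat.totient_prime_pow_succ Nat.prime_three]
    have h' : (4 * kobDefect 3 (k + 1) + 1 : ℝ) ≤ 3 * 3 ^ k := by exact_mod_cast (by simpa [pow_succ, mul_comm] using h)
    push_cast
    nlinarith [h']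

/-- **K1_defect = what twisted Kolyvagin with the standard `f`-structure can deliver at supersingular `3`**
(same binders as `C⁺`): along an unbounded set of levels `m`, for every primitive `3^m`-th root `ζ` and the value
`v = L′(ζ-1) ≠ 0`, `#(X′)_χ · |v|^{φ(3^m)} ≤ 3^{2·kobDefect 3 m + c'·φ(3^m) + B}` with a Kolyvagin error slope
`c' < 1/4`.  Unknowns: U1 (the error `c'φ+B` — Howard's DVR bound is error-free given H.0–H.5 uniformly in `χ`;
any `o(φ)` suffices) and U2 (the defect of the anticyclotomic local tower equals the model value `kobDefect 3 m + O(1)` — the `O(1)` is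
absorbed by `B` — or at least `≤ (1/2 - ε)φ(3^m)` jointly with U1). -/
def TwistedKolyvaginWithKobayashiDefectAtThree : Prop :=
  ∀ (W' : WeierstrassCurve ℚ) [W'.IsElliptic] [W'.IsGloballyMinimal] (N' : ℕ) [NeZero N'] (K : Type) [Field K]
    [NumberField K] (Dt' : Literature.NumberTheory.EllipticCurves.ModularForms.ModularParametrizationData W' N'),
    (Literature.NumberTheory.EllipticCurves.Rank1Residual.Mult W' 3 ∧ ¬ 3 ∣ padicValInt 3 W'.minimalDiscriminantInt ∨
      Literature.NumberTheory.EllipticCurves.Rank1Residual.GoodSS W' 3 ∧ W'.frobeniusTrace 3 = 0) →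
    W'.HasSurjectiveModNGaloisRep 3 → W'.conductorNorm ℤ = N' →
    Literature.NumberTheory.EllipticCurves.IsImaginaryQuadratic K →
    Literature.NumberTheory.EllipticCurves.SatisfiesHeegnerHypothesis N' K → Odd (NumberField.discr K) →
    ∀ (κ : Literature.NumberTheory.EllipticCurves.ZpExtension K 3), κ.IsAnticyclotomic →
    ∀ (γ : Field.absoluteGaloisGroup K) [Fact (κ.IsTopGenerator γ)]
      (𝔭 : IsDedekindDomain.HeightOneSpectrum (NumberField.RingOfIntegers K)),
      ((3 : ℕ) : NumberField.RingOfIntegers K) ∈ 𝔭.asIdeal →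
      𝔭.asIdeal.ramificationIdx (NumberField.RingOfIntegers ℚ) = 1 →
      𝔭.asIdeal.inertiaDeg (NumberField.RingOfIntegers ℚ) = 1 →
    ∀ (𝔭' : IsDedekindDomain.HeightOneSpectrum (NumberField.RingOfIntegers K)),
      ((3 : ℕ) : NumberField.RingOfIntegers K) ∈ 𝔭'.asIdeal → 𝔭' ≠ 𝔭 →
    ∀ (ι' : PadicAlgCl 3 ≃+* ℂ),
      Summit.BirchSwinnertonDyer.BirchSwinnertonDyer.Theorems.SchneiderFree.BranchInducesPrime 3 ι' 𝔭 →
    ∀ (ΩK : ℂ) (Ωp : ℂ_[3]) (L' : Literature.NumberTheory.EllipticCurves.UnrSeries 3), ΩK ≠ 0 → Ωp ≠ 0 →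
      Literature.NumberTheory.EllipticCurves.IsBDPLFunction ι' 𝔭 κ γ Dt'.f ΩK Ωp L' →    ∃ c' : ℝ, c' < 1 / 4 ∧ ∃ B : ℕ, ∀ m₁ : ℕ, ∃ m : ℕ, m₁ ≤ m ∧ ∀ ζ : ℂ_[3], IsPrimitiveRoot ζ (3 ^ m) → ∀ v : ℂ_[3],
      L'.HasValueAt (ζ - 1) v → v ≠ 0 →
      Finite (CharLayer (Summit.BirchSwinnertonDyer.Rank1Residual.X11b.AcSelmer.XAc (W'.baseChange K) 3 κ 𝔭' ∅ γ) m) ∧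
        (Nat.card (CharLayer (Summit.BirchSwinnertonDyer.Rank1Residual.X11b.AcSelmer.XAc (W'.baseChange K) 3 κ 𝔭' ∅ γ) m) : ℝ)
          * ‖v‖ ^ Nat.totient (3 ^ m) ≤ (3 : ℝ) ^ (2 * (kobDefect 3 m : ℝ) + c' * (Nat.totient (3 ^ m) : ℝ) + (B : ℝ))

/-- **`K1_defect ⟹ C⁺_weak` with `c = 3/4 + c' < 1`** (PROVED, from `two_mul_kobDefect_three_le`). -/
theorem weak_of_defect (hK : TwistedKolyvaginWithKobayashiDefectAtThree) : TwistedOnePointKolyvaginAtThreeWeak := by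
  intro W' _ _ N' _ K _ _ Dt' hb hs hN hK' hH ho κ hκ γ _ 𝔭 h1 h2 h3 𝔭' h4 h5 ι' hι ΩK Ωp L' hΩK hΩp hL
  obtain ⟨c', hc', B, h⟩ := hK W' N' K Dt' hb hs hN hK' hH ho κ hκ γ 𝔭 h1 h2 h3 𝔭' h4 h5 ι' hι ΩK Ωp L' hΩK hΩp hL
  refine ⟨3 / 4 + c', by linarith, B, fun m₁ ↦ ?_⟩
  obtain ⟨m, hm, hBm⟩ := h m₁
  refine ⟨m, hm, fun ζ hζ v hv hv0 ↦ ?_⟩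
  obtain ⟨hf, hi⟩ := hBm ζ hζ v hv hv0
  refine ⟨hf, hi.trans ?_⟩
  apply Real.rpow_le_rpow_of_exponent_le (by norm_num : (1 : ℝ) ≤ 3)
  have hd := two_mul_kobDefect_three_le m
  nlinarith [hd, Nat.cast_nonneg (α := ℝ) (Nat.totient (3 ^ m))]

/-- **DEFECT-ADJUSTED TRANSFER (PROVED, concludes the crux BY NAME):** twisted Kolyvagin with the standard
`f`-structure, Kobayashi defect included and a Kolyvagin error of slope `< 1/4`, plus the twin frame with analytic
`μ = 0`, gives `TwinAlgMuZeroAtThree`. -/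
theorem TwinAlgMuZeroAtThree_of_kolyvaginWithKobayashiDefect (hK : TwistedKolyvaginWithKobayashiDefectAtThree)
    (hS : TwinFrameMuSupplyAtThree) :
    Summit.BirchSwinnertonDyer.BirchSwinnertonDyer.Theses.UniversalToricDescent.TwinAlgMuZeroAtThree :=
  TwinAlgMuZeroAtThree_of_onePointSqueezeWeak (weak_of_defect hK) hS

/-! ### §12 (g65) AUDIT: the weakest and the defect-adjusted transfers conclude the crux by name; axioms of the new theorems -/

#print axioms sublinearCharLayersCriterion_holds
#print axioms TwinAlgMuZeroAtThree_of_onePointSqueezeWeak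
#print axioms TwinAlgMuZeroAtThree_of_kolyvaginWithKobayashiDefect

example : TwistedOnePointKolyvaginAtThreeWeak → TwinFrameMuSupplyAtThree →
    Summit.BirchSwinnertonDyer.BirchSwinnertonDyer.Theses.UniversalToricDescent.TwinAlgMuZeroAtThree :=
  TwinAlgMuZeroAtThree_of_onePointSqueezeWeak

example : TwistedKolyvaginWithKobayashiDefectAtThree → TwinFrameMuSupplyAtThree →
    Summit.BirchSwinnertonDyer.BirchSwinnertonDyer.Theses.UniversalToricDescent.TwinAlgMuZeroAtThree :=
  TwinAlgMuZeroAtThree_of_kolyvaginWithKobayashiDefect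

/-! ### §14 (g65) THE RESOLVENT FACTORISATION AND THE ISOTYPIC (`±`) RENORMALISATION — the imprimitivity of §13 is EXACT and REMOVABLE

§13 computed that the RESOLVENT-twisted Heegner Kolyvagin system `κ^{res}_χ` (`κ₁ = cores(z_m ⊗ χ) ↔ R_χ(z_m) =
Σ_σ χ(σ) z_m^σ`) overshoots by the Kobayashi defect.  Two remarks make this precise and show it is not the method's limit.

(1) THE RESOLVENT IS `ω_m` OVER ONE LINEAR FACTOR (`resolvent_mul_eq`, PROVED): in `O_χ[Γ_m] = O_χ[Y]/(Y^{3^m} − 1)`,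
`R_χ·(χ(γ)γ − 1) = γ^{3^m} − 1 = ω_m`, i.e. `R_χ = ζ·ω_m/(X − (ζ − 1))`, `ζ = χ(γ)⁻¹`, `X = γ − 1`.  So for ANY
factorisation `ω_m = F·F^c` in `ℤ₃[X]` with `F(ζ − 1) = 0`:  `R_χ = ζ · F^c · F̃`,  `F̃ := F/(X − (ζ − 1)) ∈ O_χ[X]`.

(2) THE `a₃ = 0` TRACE RELATIONS CHOOSE `F`.  The Heegner points `z_{m,(n)} ∈ E′(K_m[n])` (tame conductor `n`,
`3`-level `m`) satisfy `tr_{K_m/K_{m−1}} z_m = −z_{m−2}` (`m ≥ 2`) and `tr_{K_1/K_0} z_1 = ((p−1)/2)·z_0 = z_0` at `p = 3`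
(Perrin-Riou / Bertolini–Darmon; Longo–Vigni arXiv:1503.07812 §4.2 (heegner-eq), split `p`, `a_p = 0`), so the
`ℚ`-support of `ℤ₃[Γ_m]·z_{m,(n)}` lies on the levels `k ≡ m (mod 2)` together with level `0`, and the FIXED element
`F := ω_m^{ε(m)} = X·∏_{1 ≤ k ≤ m, k ≡ m (2)} Φ_{3^k}(1+X)` (Longo–Vigni's / Castella–Wan's `ω_m^±`) annihilates every
`z_{m,(n)}`.  Put `F^c := ω_m/F = ω̃_m^{−ε(m)} = ∏_{1 ≤ k < m, k ≢ m (2)} Φ_{3^k}(1+X)`, of degree EXACTLY `kobDefect 3 m`.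
Then `z^{iso}_{χ,(n)} := F̃(γ−1)·z_{m,(n)}` is `χ̄`-ISOTYPIC (`(X − (ζ−1))·F̃ = F` kills `z`), hence — by inflation–restriction,
an isomorphism `H¹(K[n], T_χ) ≅ (H¹(K_m[n], T) ⊗ O_χ)^{iso}` because `E′(K_m[n])[3] = 0` — a class
`c^{iso}_n ∈ H¹(K[n], T_χ)`; the family `{c^{iso}_n}_n` is an Euler system for `T_χ` (the tame norm operators commute with
`F̃(γ−1) ∈ O_χ[Γ_m]`), and the resolvent system is the scalar multiple
        `c^{res}_n = F^c(ζ̄_χ − 1) · c^{iso}_n`,   `v_π(F^c(ζ_χ − 1)) = deg F^c = kobDefect 3 m`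
(`norm_prod_sub_lower_level_roots`, PROVED: each of the `kobDefect 3 m` lower-level roots `η` of `F^c` costs exactly one
`π`, `‖ζ − η‖^{φ(3^m)} = 3⁻¹`).  This is the finite-level, single-character shadow of the printed `±` Heegner classes
(`ω̃_n^{−ε}·z_n^ε = ±z_n`, Castella–Wan arXiv:1607.02019 §5.1, `p > 3`, Λ-adic; their interpolation formula p. 19 carries
the same factor `ω̃_n^−(φ)`), and it needs NO Λ-adic object: one fixed group-ring element applied to one finite-level point.

CONSEQUENCE — TWO ROADS, TWO SAFETY MARGINS at `a₃ = 0`: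
* ISOTYPIC road (`κ^{iso}`): Howard's bound gives `ℓ(Sel_{(∅,0)}^∨_χ) ≤ 2·locind^{iso}(z^{iso}) + err
  = φ(3^m)·v₃L′(ζ−1) + 2·(d_χ − kobDefect 3 m) + err`, and `d_χ − kobDefect 3 m = O(1)` is the local statement U2
  (generation of the formal-group points à la Kobayashi/Kim); so the SHARP `C⁺ = TwistedOnePointKolyvaginAtThree` (§3) IS what
  the method proves, modulo U1 (the `m`-uniform DVR bound) and U2 — §13's "false as a method" applies to the resolvent road only.
* RESOLVENT road (`κ^{res}`): loses exactly `2·kobDefect 3 m ≤ (3/4)·φ(3^m)` and still concludes through P2′ (§11/§13: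
  `TwinAlgMuZeroAtThree_of_kolyvaginWithKobayashiDefect`), with NO appeal to the trace relations or to U2 beyond
  `d_χ ≤ kobDefect + (1/8 − ε)φ` jointly with U1.
Either road gives `μ = 0`; the crux is reached by `TwinAlgMuZeroAtThree_of_onePointSqueeze` (sharp) or
`…_of_kolyvaginWithKobayashiDefect` (slack), both PROVED.  The integer-reading of `μ` is what makes the second road exist;
the `±` renormalisation is what makes the first road sharp. -/

/-- **Resolvent factorisation** (PROVED).  In any commutative ring, for `c` with `c ^ N = 1` (`c = χ(γ)`, `N = 3^m`,
`Y = γ`): `(Σ_{j<N} (cY)^j)·(cY − 1) = Y^N − 1`; i.e. `R_χ = Σ_j χ(γ)^j γ^j = ω_m/(χ(γ)γ − 1)` in `O_χ[Γ_m]`. -/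
theorem resolvent_mul_eq (A : Type*) [CommRing A] (c Y : A) (N : ℕ) (hc : c ^ N = 1) :
    (∑ j ∈ Finset.range N, (c * Y) ^ j) * (c * Y - 1) = Y ^ N - 1 := by
  rw [geom_sum_mul, mul_pow, hc, one_mul]

/-- A primitive `3^(m+1)`-th root of unity times a root of unity of LOWER level `3^k`, `k ≤ m`, is again
primitive of level `m+1` (PROVED). -/
theorem isPrimitiveRoot_mul_of_lower_level {M : Type*} [CommMonoid M] {ζ η : M} {m k : ℕ}
    (hζ : IsPrimitiveRoot ζ (3 ^ (m + 1))) (hη : η ^ 3 ^ k = 1) (hk : k ≤ m) :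
    IsPrimitiveRoot (ζ * η) (3 ^ (m + 1)) := by
  haveI : Fact (Nat.Prime 3) := ⟨Nat.prime_three⟩
  have hηm : ∀ d : ℕ, k ≤ d → η ^ 3 ^ d = 1 := by
    intro d hd
    obtain ⟨e, rfl⟩ := Nat.exists_eq_add_of_le hd
    rw [pow_add, pow_mul, hη, one_pow]
  rw [IsPrimitiveRoot.iff_orderOf]
  apply orderOf_eq_prime_pow
  · intro h
    rw [mul_pow, hηm m hk, mul_one] at h
    have hdvd := hζ.dvd_of_pow_eq_one _ h
    have : 3 ^ (m + 1) ≤ 3 ^ m := Nat.le_of_dvd (pow_pos (by norm_num) _) hdvd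
    have : 3 ^ m < 3 ^ (m + 1) := Nat.pow_lt_pow_right (by norm_num) (Nat.lt_succ_self m)
    omega
  · rw [mul_pow, hζ.pow_eq_one, one_mul, hηm (m + 1) (Nat.le_succ_of_le hk)]

/-- **Each lower-level factor costs exactly one `π`** (PROVED from P0).  For `ζ ∈ ℂ₃` primitive of level `m+1` and
`η` a `3^k`-th root of unity with `k ≤ m`: `‖ζ − η‖^{φ(3^{m+1})} = 3⁻¹` (`ζ − η = −ζ·(ζ⁻¹η − 1)` with `ζ⁻¹η` primitive
of level `m+1`). -/
theorem norm_sub_lower_level_root {ζ η : ℂ_[3]} {m k : ℕ}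
    (hζ : IsPrimitiveRoot ζ (3 ^ (m + 1))) (hη : η ^ 3 ^ k = 1) (hk : k ≤ m) :
    ‖ζ - η‖ ^ Nat.totient (3 ^ (m + 1)) = (3 : ℝ)⁻¹ := by
  have hζ1 : ‖ζ‖ = 1 := norm_eq_one_of_isPrimitiveRoot hζ
  have hζ0 : ζ ≠ 0 := by
    intro h; rw [h, norm_zero] at hζ1; exact zero_ne_one hζ1
  have hprim : IsPrimitiveRoot (ζ⁻¹ * η) (3 ^ (m + 1)) :=
    isPrimitiveRoot_mul_of_lower_level (IsPrimitiveRoot.inv_iff.2 hζ) hη hk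
  have hfac : ζ - η = -ζ * (ζ⁻¹ * η - 1) := by
    field_simp
    ring
  rw [hfac, norm_mul, norm_neg, hζ1, one_mul]
  exact primitiveRootNormAtThree_holds (m + 1) (Nat.succ_le_succ (Nat.zero_le m)) _ hprim

/-- **The valuation of `F^c(ζ_χ − 1)` is its number of roots** (PROVED): a finite set `S` of lower-level roots of unity
costs exactly `#S` factors `3^{−1/φ(3^{m+1})}` — `‖∏_{η ∈ S} (ζ − η)‖^{φ(3^{m+1})} = 3^{−#S}`.  With `S` = the roots of
`ω̃^{−ε}_{m+1}` (`#S = kobDefect 3 (m+1)`), this is `v_π(ω̃^{−ε}(ζ_χ − 1)) = kobDefect` on the nose: the resolvent Kolyvagin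
system is `π^{kobDefect 3 m}` times the isotypic one. -/
theorem norm_prod_sub_lower_level_roots {ζ : ℂ_[3]} {m : ℕ} (hζ : IsPrimitiveRoot ζ (3 ^ (m + 1)))
    (S : Finset ℂ_[3]) (hS : ∀ η ∈ S, ∃ k ≤ m, η ^ 3 ^ k = 1) :
    ‖∏ η ∈ S, (ζ - η)‖ ^ Nat.totient (3 ^ (m + 1)) = (3 : ℝ)⁻¹ ^ S.card := by
  rw [norm_prod, ← Finset.prod_pow, Finset.prod_congr rfl (fun η hη => by
      obtain ⟨k, hk, hηk⟩ := hS η hη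
      exact norm_sub_lower_level_root hζ hηk hk), Finset.prod_const]


end Summit.BirchSwinnertonDyer.BirchSwinnertonDyer.Cruxes.TwinAlgMuZeroAtThree.OnePointSqueeze

end
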